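import Mathlib.Data.Fintype.EquivFin
import Mathlib.Data.Fintype.BigOperators
import Mathlib.Data.Fintype.Pi
import Mathlib.Data.Fintype.Prod
import Mathlib.Combinatorics.Enumerative.DoubleCounting
import Mathlib.Data.Nat.Choose.Bounds
import Literature.Computability.MetaComplexity.PartialBijections
import Mathlib.Tactic.Ring
import HarnessLib

/-!
# The PHP switching lemma (Krajíček–Pudlák–Woods) via the game and the coding argument

Topic `Literature/Computability/MetaComplexity`. A complete proof of the *PHP switching lemma*
(Krajíček 1995, Lemma 12.3.10; Krajíček–Pudlák–Woods 1995; cf. Krajíček 2019, Lemma 15.2.2)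
for complete systems of partial bijections (`PartialBijections.lean`), in counting form:
given sets `H₀, …, H_{N-1}` of matchings of norm `≤ t` over a universe `D × R` with
`|D| = |R| + 1`, and `w, s` with an explicit counting inequality, there is a matching `ρ` of
size `w` such that every `Hᵢ^ρ` is refined by a `2s`-complete system over the restricted
universe (`PBij.php_switching`).

1. **The game** (proof of Lemma 12.3.10, steps 1–3): given an enumeration `L` of `H` and a
   position `δ`, player I plays the first `h ∈ L` compatible with `δ` (`firstCompat`); the pairs
   of `h ∖ δ` are the *critical pairs* (`crit`); player II answers with a `⊆`-minimal matching of
   fresh pairs covering the critical pigeons and holes (`responses`); plays (`PlayValid`,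
   `playEnd`, `playCrit`), goodness (`Good`: every play meets `≤ s` critical pairs).
2. **The complete system of finished plays** (`leafSystem`): `2s`-complete when `ρ` is good
   (`isKComplete_leafSystem`, Claim (a) with step 6) and refining `H^ρ` (`refines_leafSystem`,
   Claim (b)); completeness is player II following a prescribed matching
   (`exists_response_compat`, `exists_finished_play_compat`).
3. **The coding argument** (steps 4–12): for a bad `ρ` the matching `τ = ρ ∪` (first `s+1`
   critical pairs) (`tauSet`) and a code with three bounded indices per critical pair (`encode`)
   determine `ρ` (`decRounds_encode`, `tauSet_sdiff_decRounds`).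
4. **Counting** (step 13): double counting the pairs `ρ ⊆ τ` (`card_matchings_mul_choose_le`)
   and the injection give `exists_good_restriction` and `php_switching`.

## References

* J. Krajíček, *Bounded arithmetic, propositional logic, and complexity theory*, CUP 1995,
  Lemma 12.3.10 and its proof (steps 1–13) [Krajicek1995].
* J. Krajíček, P. Pudlák, A. Woods, Random Structures Algorithms 7 (1995) 15–39
  [KrajicekPudlakWoods1995].
* J. Krajíček, *Proof complexity*, CUP 2019, Lemma 15.2.2 (proof, Claims 1–2) [Krajicek2019].
* N. Thapen, *Notes on switching lemmas*, arXiv:2202.05651, §3 (the same coding for PHP).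

## Design choices

* Player II's moves are exactly Krajíček's `⊆`-minimal covers; an answer is determined by its
  values on critical pigeons and preimages of critical holes (`response_eq_union_filter`),
  which is what the code records.
* The sufficient inequality is
  `N · ((t+1)(|R|+t-w+1)² · 2)^{s+1} · ((|D|-w)(|R|-w))^{s+1} < C(w+s+1, w)`, of the same shape
  as Krajíček's `w^s / ((n+1-w)^{4s} t^{3s}) > N` but with cruder constants (we bound the
  number of extensions of `ρ` by `((|D|-w)(|R|-w))^{s+1}` and code values by indices below
  `|R| + t - w + 1`). Only the shape matters for the application (Thm. 12.4.3).
* Sets `Hᵢ` are given as lists (an enumeration is part of the game); `N` and the lists are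
  indexed by `ℕ` with a bound `i < N`.
-/

namespace Literature.Computability.MetaComplexity.PBij

variable {α β : Type*} [DecidableEq α] [DecidableEq β]

/-! ### More on matchings -/

/-- The union of two matchings with disjoint domains and disjoint ranges is a matching.
[folklore] -/
theorem IsPMatching.union {σ τ : Finset (α × β)} (hσ : IsPMatching σ) (hτ : IsPMatching τ)
    (hd : Disjoint (dom σ) (dom τ)) (hr : Disjoint (rng σ) (rng τ)) : IsPMatching (σ ∪ τ) := by
  rw [← Compat, compat_iff]
  refine ⟨hσ, hτ, fun p hp q hq hpq => ?_⟩
  obtain ⟨pa, pb⟩ := p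
  obtain ⟨qa, qb⟩ := q
  simp only at hpq
  rcases hpq with rfl | rfl
  · exact absurd (mem_dom.2 ⟨qb, hq⟩) (Finset.disjoint_left.1 hd (mem_dom.2 ⟨pb, hp⟩))
  · exact absurd (mem_rng.2 ⟨qa, hq⟩) (Finset.disjoint_left.1 hr (mem_rng.2 ⟨pa, hp⟩))

/-- Two matchings with disjoint domains and disjoint ranges are compatible. [folklore] -/
theorem IsPMatching.compat_of_disjoint {σ τ : Finset (α × β)} (hσ : IsPMatching σ)
    (hτ : IsPMatching τ) (hd : Disjoint (dom σ) (dom τ)) (hr : Disjoint (rng σ) (rng τ)) :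
    Compat σ τ :=
  hσ.union hτ hd hr

omit [DecidableEq β] in
/-- `|dom σ| ≤ |σ|` for any set of pairs. [folklore] -/
theorem card_dom_le (σ : Finset (α × β)) : (dom σ).card ≤ σ.card :=
  Finset.card_image_le

omit [DecidableEq α] in
/-- `|rng σ| ≤ |σ|` for any set of pairs. [folklore] -/
theorem card_rng_le (σ : Finset (α × β)) : (rng σ).card ≤ σ.card :=
  Finset.card_image_le

/-- Incompatibility is monotone: a set incompatible with `δ` is incompatible with every
superset of `δ`. [folklore] -/
theorem not_compat_mono {h δ τ : Finset (α × β)} (hn : ¬ Compat h δ) (hδτ : δ ⊆ τ) :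
    ¬ Compat h τ :=
  fun hc => hn (hc.mono_right hδτ)

/-! ### The game: first compatible element, critical pairs, responses, plays -/

/-- Player I's move: the first element of the enumeration `L` compatible with the current
position `δ`. [cite: Krajicek1995, Lemma 12.3.10 (proof, step 2(a))] -/
def firstCompat (L : List (Finset (α × β))) (δ : Finset (α × β)) : Option (Finset (α × β)) :=
  L.find? fun h => decide (Compat h δ)

/-- The *critical pairs* at position `δ`: the pairs of player I's move not yet in `δ`
(`∅` if player I cannot move). [cite: Krajicek1995, Lemma 12.3.10 (proof, step 5)] -/
def crit (L : List (Finset (α × β))) (δ : Finset (α × β)) : Finset (α × β) :=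
  ((firstCompat L δ).getD ∅) \ δ

/-- Player II's possible answers to the critical pairs `κ` at position `δ`: the `⊆`-minimal
matchings `ν` of fresh pairs (pigeons outside `dom δ`, holes outside `rng δ`, inside the
universe `D × R`) whose domain contains the critical pigeons and whose range contains the
critical holes; minimality means every pair of `ν` serves a critical pigeon or a critical hole.
[cite: Krajicek1995, Lemma 12.3.10 (proof, step 2(b))] -/
def responses (D : Finset α) (R : Finset β) (δ κ : Finset (α × β)) : Finset (Finset (α × β)) :=
  (((D \ dom δ) ×ˢ (R \ rng δ)).powerset).filter fun ν =>
    IsPMatching ν ∧ dom κ ⊆ dom ν ∧ rng κ ⊆ rng ν ∧ ∀ p ∈ ν, p.1 ∈ dom κ ∨ p.2 ∈ rng κ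

/-- A (partial) play from position `δ`, given by the list of player II's answers: each answer
responds to a nonempty critical set. [cite: Krajicek1995, Lemma 12.3.10 (proof, step 2)] -/
def PlayValid (L : List (Finset (α × β))) (D : Finset α) (R : Finset β) :
    Finset (α × β) → List (Finset (α × β)) → Prop
  | _, [] => True
  | δ, ν :: rest => crit L δ ≠ ∅ ∧ ν ∈ responses D R δ (crit L δ) ∧ PlayValid L D R (δ ∪ ν) rest

/-- The position reached by a play. [cite: Krajicek1995, Lemma 12.3.10 (proof, step 2)] -/
def playEnd : Finset (α × β) → List (Finset (α × β)) → Finset (α × β)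
  | δ, [] => δ
  | δ, ν :: rest => playEnd (δ ∪ ν) rest

/-- The number of critical pairs answered along a play. [cite: Krajicek1995, Lemma 12.3.10 (proof, step 5)] -/
def playCrit (L : List (Finset (α × β))) : Finset (α × β) → List (Finset (α × β)) → ℕ
  | _, [] => 0
  | δ, ν :: rest => (crit L δ).card + playCrit L (δ ∪ ν) rest

/-- `ρ` is *good* (for threshold `s`): along every play from `ρ`, the critical pairs met —
those answered plus those currently pending — number at most `s`.
[cite: Krajicek1995, Lemma 12.3.10 (proof, step 6)] -/
def Good (L : List (Finset (α × β))) (D : Finset α) (R : Finset β) (ρ : Finset (α × β)) (s : ℕ) :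
    Prop :=
  ∀ play, PlayValid L D R ρ play →
    playCrit L ρ play + (crit L (playEnd ρ play)).card ≤ s

/-! ### Player I's move -/

omit [DecidableEq α] [DecidableEq β] in
/-- `List.find?` with a decidable proposition: characterisation of `some`. [folklore] -/
theorem find?_decide_eq_some {P : Finset (α × β) → Prop} [DecidablePred P]
    {L : List (Finset (α × β))} {h : Finset (α × β)} :
    L.find? (fun x => decide (P x)) = some h ↔
      P h ∧ ∃ as bs, L = as ++ h :: bs ∧ ∀ a ∈ as, ¬ P a := by
  rw [List.find?_eq_some_iff_append]
  simp only [decide_eq_true_eq, Bool.not_eq_eq_eq_not, Bool.not_true, decide_eq_false_iff_not]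

/-- If player I moves `h` at `δ`, then `h ∈ L` and `h` is compatible with `δ`.
[cite: Krajicek1995, Lemma 12.3.10 (proof, step 2(a))] -/
theorem firstCompat_spec {L : List (Finset (α × β))} {δ h : Finset (α × β)}
    (hf : firstCompat L δ = some h) : h ∈ L ∧ Compat h δ := by
  unfold firstCompat at hf
  obtain ⟨hc, as, bs, rfl, _⟩ := find?_decide_eq_some.1 hf
  exact ⟨by simp, hc⟩

/-- Player I's move is *stable*: if `h` is the first element compatible with `δ`, `δ ⊆ τ` and
`h` is still compatible with `τ`, then `h` is the first element compatible with `τ` (this is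
what makes the coding argument of Lemma 12.3.10 work). [cite: Krajicek1995, Lemma 12.3.10 (proof, step 12)] -/
theorem firstCompat_of_subset {L : List (Finset (α × β))} {δ τ h : Finset (α × β)}
    (hf : firstCompat L δ = some h) (hδτ : δ ⊆ τ) (hc : Compat h τ) : firstCompat L τ = some h := by
  unfold firstCompat at hf ⊢
  obtain ⟨_, as, bs, rfl, has⟩ := find?_decide_eq_some.1 hf
  exact find?_decide_eq_some.2 ⟨hc, as, bs, rfl, fun a ha => not_compat_mono (has a ha) hδτ⟩

/-- Player I cannot move iff no element of `L` is compatible with `δ`.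
[cite: Krajicek1995, Lemma 12.3.10 (proof, step 2)] -/
theorem firstCompat_eq_none {L : List (Finset (α × β))} {δ : Finset (α × β)} :
    firstCompat L δ = none ↔ ∀ h ∈ L, ¬ Compat h δ := by
  unfold firstCompat
  rw [List.find?_eq_none]
  simp

/-- The critical set when player I moves `h`. [cite: Krajicek1995, Lemma 12.3.10 (proof, step 5)] -/
theorem crit_eq_of_some {L : List (Finset (α × β))} {δ h : Finset (α × β)}
    (hf : firstCompat L δ = some h) : crit L δ = h \ δ := by
  rw [crit, hf, Option.getD_some]

/-- The critical set when player I cannot move. [cite: Krajicek1995, Lemma 12.3.10 (proof, step 5)] -/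
theorem crit_eq_of_none {L : List (Finset (α × β))} {δ : Finset (α × β)}
    (hf : firstCompat L δ = none) : crit L δ = ∅ := by
  rw [crit, hf, Option.getD_none, Finset.empty_sdiff]

/-- A nonempty critical set comes from a move of player I not contained in `δ`.
[cite: Krajicek1995, Lemma 12.3.10 (proof, step 5)] -/
theorem exists_of_crit_ne_empty {L : List (Finset (α × β))} {δ : Finset (α × β)}
    (hne : crit L δ ≠ ∅) : ∃ h, firstCompat L δ = some h ∧ crit L δ = h \ δ ∧ ¬ h ⊆ δ := by
  cases hf : firstCompat L δ with
  | none => exact absurd (crit_eq_of_none hf) hne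
  | some h =>
    refine ⟨h, rfl, crit_eq_of_some hf, fun hsub => hne ?_⟩
    rw [crit_eq_of_some hf, Finset.sdiff_eq_empty_iff_subset]
    exact hsub

/-- Critical pairs are fresh: their pigeons are outside `dom δ` and their holes outside
`rng δ` (because player I's move is compatible with `δ`). [cite: Krajicek1995, Lemma 12.3.10 (proof, step 5)] -/
theorem crit_fresh {L : List (Finset (α × β))} {δ : Finset (α × β)} {p : α × β}
    (hp : p ∈ crit L δ) : p.1 ∉ dom δ ∧ p.2 ∉ rng δ := by
  cases hf : firstCompat L δ with
  | none => rw [crit_eq_of_none hf] at hp; exact absurd hp (Finset.notMem_empty p)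
  | some h =>
    rw [crit_eq_of_some hf, Finset.mem_sdiff] at hp
    have hc := (firstCompat_spec hf).2
    exact ⟨fun hd => hp.2 (hc.mem_of_mem_of_mem_dom hp.1 hd),
      fun hr => hp.2 (hc.mem_of_mem_of_mem_rng hp.1 hr)⟩

/-- The critical set is part of an element of `L`; hence it is a matching of the universe of
norm at most `t` whenever the elements of `L` are. [cite: Krajicek1995, Lemma 12.3.10 (proof, step 5)] -/
theorem crit_subset_of_mem {L : List (Finset (α × β))} {δ : Finset (α × β)}
    (hne : crit L δ ≠ ∅) : ∃ h ∈ L, crit L δ ⊆ h ∧ Compat h δ := by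
  obtain ⟨h, hf, hc, -⟩ := exists_of_crit_ne_empty hne
  exact ⟨h, (firstCompat_spec hf).1, hc ▸ Finset.sdiff_subset, (firstCompat_spec hf).2⟩

/-- The critical set is a matching (when `L` consists of matchings). [folklore] -/
theorem isPMatching_crit {L : List (Finset (α × β))} (hL : ∀ h ∈ L, IsPMatching h)
    (δ : Finset (α × β)) : IsPMatching (crit L δ) := by
  by_cases hne : crit L δ = ∅
  · rw [hne]; exact IsPMatching.empty
  · obtain ⟨h, hh, hsub, -⟩ := crit_subset_of_mem hne
    exact (hL h hh).subset hsub

/-- The critical set lies in the universe (when `L` does). [folklore] -/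
theorem crit_subset_universe {L : List (Finset (α × β))} {D : Finset α} {R : Finset β}
    (hL : ∀ h ∈ L, h ⊆ D ×ˢ R) (δ : Finset (α × β)) : crit L δ ⊆ D ×ˢ R := by
  by_cases hne : crit L δ = ∅
  · rw [hne]; exact Finset.empty_subset _
  · obtain ⟨h, hh, hsub, -⟩ := crit_subset_of_mem hne
    exact hsub.trans (hL h hh)

/-- The critical set has norm at most `t` (when `L` does). [folklore] -/
theorem card_crit_le {L : List (Finset (α × β))} {t : ℕ} (hL : ∀ h ∈ L, h.card ≤ t)
    (δ : Finset (α × β)) : (crit L δ).card ≤ t := by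
  by_cases hne : crit L δ = ∅
  · rw [hne, Finset.card_empty]; exact Nat.zero_le _
  · obtain ⟨h, hh, hsub, -⟩ := crit_subset_of_mem hne
    exact (Finset.card_le_card hsub).trans (hL h hh)

/-! ### Player II's answers -/

/-- Membership in `responses`. [cite: Krajicek1995, Lemma 12.3.10 (proof, step 2(b))] -/
theorem mem_responses {D : Finset α} {R : Finset β} {δ κ ν : Finset (α × β)} :
    ν ∈ responses D R δ κ ↔ ν ⊆ (D \ dom δ) ×ˢ (R \ rng δ) ∧ IsPMatching ν ∧ dom κ ⊆ dom ν ∧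
      rng κ ⊆ rng ν ∧ ∀ p ∈ ν, p.1 ∈ dom κ ∨ p.2 ∈ rng κ := by
  simp only [responses, Finset.mem_filter, Finset.mem_powerset]

/-- An answer is disjoint in coordinates from the current position. [folklore] -/
theorem response_disjoint {D : Finset α} {R : Finset β} {δ κ ν : Finset (α × β)}
    (hν : ν ∈ responses D R δ κ) : Disjoint (dom δ) (dom ν) ∧ Disjoint (rng δ) (rng ν) := by
  have hs := (mem_responses.1 hν).1
  constructor
  · rw [Finset.disjoint_right]
    intro a ha
    exact (Finset.mem_sdiff.1 (dom_subset_of_subset_product hs ha)).2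
  · rw [Finset.disjoint_right]
    intro b hb
    exact (Finset.mem_sdiff.1 (rng_subset_of_subset_product hs hb)).2

/-- Hence position plus answer is again a matching. [folklore] -/
theorem isPMatching_union_response {D : Finset α} {R : Finset β} {δ κ ν : Finset (α × β)}
    (hδ : IsPMatching δ) (hν : ν ∈ responses D R δ κ) : IsPMatching (δ ∪ ν) :=
  hδ.union (mem_responses.1 hν).2.1 (response_disjoint hν).1 (response_disjoint hν).2

/-- An answer lies in the universe. [folklore] -/
theorem response_subset_universe {D : Finset α} {R : Finset β} {δ κ ν : Finset (α × β)}
    (hν : ν ∈ responses D R δ κ) : ν ⊆ D ×ˢ R :=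
  (mem_responses.1 hν).1.trans (Finset.product_subset_product Finset.sdiff_subset Finset.sdiff_subset)

/-- An answer is disjoint from the current position (as a set of pairs). [folklore] -/
theorem disjoint_response {D : Finset α} {R : Finset β} {δ κ ν : Finset (α × β)}
    (hν : ν ∈ responses D R δ κ) : Disjoint δ ν := by
  rw [Finset.disjoint_left]
  intro p hpδ hpν
  exact Finset.disjoint_left.1 (response_disjoint hν).1 (mem_dom.2 ⟨p.2, hpδ⟩) (mem_dom.2 ⟨p.2, hpν⟩)

/-- By minimality an answer has at most twice as many pairs as there are critical pairs.
[cite: Krajicek1995, Lemma 12.3.10 (proof, step 6: ‖S‖ ≤ 2s)] -/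
theorem card_response_le {D : Finset α} {R : Finset β} {δ κ ν : Finset (α × β)}
    (hν : ν ∈ responses D R δ κ) : ν.card ≤ 2 * κ.card := by
  obtain ⟨-, hνm, -, -, hmin⟩ := mem_responses.1 hν
  have hsplit : ν ⊆ ν.filter (fun p => p.1 ∈ dom κ) ∪ ν.filter (fun p => p.2 ∈ rng κ) := by
    intro p hp
    rw [Finset.mem_union, Finset.mem_filter, Finset.mem_filter]
    exact (hmin p hp).imp (fun h => ⟨hp, h⟩) (fun h => ⟨hp, h⟩)
  have h1 : (ν.filter fun p => p.1 ∈ dom κ).card ≤ κ.card := by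
    calc (ν.filter fun p => p.1 ∈ dom κ).card
        = ((ν.filter fun p => p.1 ∈ dom κ).image Prod.fst).card := by
          rw [Finset.card_image_of_injOn]
          intro p hp q hq hpq
          rw [Finset.coe_filter] at hp hq
          exact hνm p hp.1 q hq.1 (Or.inl hpq)
      _ ≤ (dom κ).card := by
          refine Finset.card_le_card fun a ha => ?_
          obtain ⟨p, hp, rfl⟩ := Finset.mem_image.1 ha
          exact (Finset.mem_filter.1 hp).2
      _ ≤ κ.card := card_dom_le κ
  have h2 : (ν.filter fun p => p.2 ∈ rng κ).card ≤ κ.card := by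
    calc (ν.filter fun p => p.2 ∈ rng κ).card
        = ((ν.filter fun p => p.2 ∈ rng κ).image Prod.snd).card := by
          rw [Finset.card_image_of_injOn]
          intro p hp q hq hpq
          rw [Finset.coe_filter] at hp hq
          exact hνm p hp.1 q hq.1 (Or.inr hpq)
      _ ≤ (rng κ).card := by
          refine Finset.card_le_card fun b hb => ?_
          obtain ⟨p, hp, rfl⟩ := Finset.mem_image.1 hb
          exact (Finset.mem_filter.1 hp).2
      _ ≤ κ.card := card_rng_le κ
  calc ν.card ≤ (ν.filter (fun p => p.1 ∈ dom κ) ∪ ν.filter (fun p => p.2 ∈ rng κ)).card :=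
        Finset.card_le_card hsplit
    _ ≤ _ := Finset.card_union_le _ _
    _ ≤ 2 * κ.card := by omega

/-- An answer to a nonempty critical set is nonempty. [folklore] -/
theorem response_nonempty {D : Finset α} {R : Finset β} {δ κ ν : Finset (α × β)}
    (hν : ν ∈ responses D R δ κ) (hκ : κ ≠ ∅) : ν.Nonempty := by
  obtain ⟨p, hp⟩ := Finset.nonempty_iff_ne_empty.2 hκ
  obtain ⟨b, hb⟩ := mem_dom.1 ((mem_responses.1 hν).2.2.1 (mem_dom.2 ⟨p.2, hp⟩))
  exact ⟨_, hb⟩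

/-- An answer is determined by its values on the critical pigeons and its preimages of the
critical holes: it is the union of these two graphs (minimality). This is the form in which an
answer is *coded* in Lemma 12.3.10. [cite: Krajicek1995, Lemma 12.3.10 (proof, steps 7 and 9)] -/
theorem response_eq_union_filter {D : Finset α} {R : Finset β} {δ κ ν : Finset (α × β)}
    (hν : ν ∈ responses D R δ κ) :
    ν = ν.filter (fun p => p.1 ∈ dom κ) ∪ ν.filter (fun p => p.2 ∈ rng κ) := by
  obtain ⟨-, -, -, -, hmin⟩ := mem_responses.1 hν
  ext p
  rw [Finset.mem_union, Finset.mem_filter, Finset.mem_filter]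
  exact ⟨fun hp => (hmin p hp).imp (fun h => ⟨hp, h⟩) (fun h => ⟨hp, h⟩),
    fun h => h.elim And.left And.left⟩

/-- **Two different answers to the same critical set are incompatible** (hence so are the
positions they lead to and all later positions): both assign values to all critical pigeons
and preimages to all critical holes, and by minimality consist of nothing else.
[cite: Krajicek1995, Lemma 12.3.10 (proof, step 3, Claim (a))] -/
theorem eq_of_compat_of_mem_responses {D : Finset α} {R : Finset β} {δ κ ν₁ ν₂ : Finset (α × β)}
    (h₁ : ν₁ ∈ responses D R δ κ) (h₂ : ν₂ ∈ responses D R δ κ) (hc : Compat ν₁ ν₂) : ν₁ = ν₂ := by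
  -- by symmetry it suffices to prove inclusion
  suffices key : ∀ {ν ν' : Finset (α × β)}, ν ∈ responses D R δ κ → ν' ∈ responses D R δ κ →
      Compat ν ν' → ν ⊆ ν' from
    Finset.Subset.antisymm (key h₁ h₂ hc) (key h₂ h₁ hc.symm)
  intro ν ν' hν hν' hc p hp
  obtain ⟨-, -, hdom', hrng', -⟩ := mem_responses.1 hν'
  obtain ⟨-, -, -, -, hmin⟩ := mem_responses.1 hν
  rcases hmin p hp with hd | hr
  · exact hc.mem_of_mem_of_mem_dom hp (hdom' hd)
  · exact hc.mem_of_mem_of_mem_rng hp (hrng' hr)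

/-- Positions extended by different answers to the same critical set are incompatible.
[cite: Krajicek1995, Lemma 12.3.10 (proof, step 3, Claim (a))] -/
theorem not_compat_union_of_ne {D : Finset α} {R : Finset β} {δ κ ν₁ ν₂ : Finset (α × β)}
    (h₁ : ν₁ ∈ responses D R δ κ) (h₂ : ν₂ ∈ responses D R δ κ) (hne : ν₁ ≠ ν₂) :
    ¬ Compat (δ ∪ ν₁) (δ ∪ ν₂) := fun hc =>
  hne (eq_of_compat_of_mem_responses h₁ h₂
    ((hc.mono_left Finset.subset_union_right).mono_right Finset.subset_union_right))

/-! ### Plays -/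

/-- The end position extends the start position. [folklore] -/
theorem subset_playEnd : ∀ (δ : Finset (α × β)) (play : List (Finset (α × β))), δ ⊆ playEnd δ play
  | _, [] => le_rfl
  | δ, ν :: rest => Finset.subset_union_left.trans (subset_playEnd (δ ∪ ν) rest)

/-- `playEnd` of a concatenation. [folklore] -/
theorem playEnd_append : ∀ (δ : Finset (α × β)) (p q : List (Finset (α × β))),
    playEnd δ (p ++ q) = playEnd (playEnd δ p) q
  | _, [], _ => rfl
  | δ, ν :: rest, q => playEnd_append (δ ∪ ν) rest q

/-- `playCrit` of a concatenation. [folklore] -/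
theorem playCrit_append (L : List (Finset (α × β))) : ∀ (δ : Finset (α × β)) (p q : List (Finset (α × β))),
    playCrit L δ (p ++ q) = playCrit L δ p + playCrit L (playEnd δ p) q
  | _, [], _ => by simp [playCrit, playEnd]
  | δ, ν :: rest, q => by
    rw [List.cons_append, playCrit, playCrit, playCrit_append L (δ ∪ ν) rest q, playEnd,
      Nat.add_assoc]

/-- Validity of a concatenation. [folklore] -/
theorem playValid_append {L : List (Finset (α × β))} {D : Finset α} {R : Finset β} :
    ∀ {δ : Finset (α × β)} {p q : List (Finset (α × β))},
      PlayValid L D R δ (p ++ q) ↔ PlayValid L D R δ p ∧ PlayValid L D R (playEnd δ p) q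
  | _, [], _ => by simp [PlayValid, playEnd]
  | δ, ν :: rest, q => by
    rw [List.cons_append, PlayValid, PlayValid, playValid_append, playEnd, and_assoc, and_assoc]

/-- Along a valid play the position stays a matching of the universe containing the start.
[folklore] -/
theorem playEnd_invariant {L : List (Finset (α × β))} {D : Finset α} {R : Finset β} :
    ∀ {δ : Finset (α × β)} {play : List (Finset (α × β))}, PlayValid L D R δ play →
      IsPMatching δ → δ ⊆ D ×ˢ R →
      IsPMatching (playEnd δ play) ∧ playEnd δ play ⊆ D ×ˢ R
  | _, [], _, hδ, hδs => ⟨hδ, hδs⟩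
  | δ, ν :: rest, hv, hδ, hδs => by
    rw [PlayValid] at hv
    rw [playEnd]
    exact playEnd_invariant (δ := δ ∪ ν) (play := rest) hv.2.2
      (isPMatching_union_response hδ hv.2.1)
      (Finset.union_subset hδs (response_subset_universe hv.2.1))

/-- Along a valid play at most twice as many pairs are added as critical pairs are answered.
[cite: Krajicek1995, Lemma 12.3.10 (proof, step 6)] -/
theorem card_playEnd_sdiff_le {L : List (Finset (α × β))} {D : Finset α} {R : Finset β} :
    ∀ {δ : Finset (α × β)} {play : List (Finset (α × β))}, PlayValid L D R δ play →
      (playEnd δ play \ δ).card ≤ 2 * playCrit L δ play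
  | _, [], _ => by simp [playEnd, playCrit]
  | δ, ν :: rest, hv => by
    rw [PlayValid] at hv
    have ih := card_playEnd_sdiff_le hv.2.2
    have hν := card_response_le hv.2.1
    rw [playEnd, playCrit]
    have hsub : playEnd (δ ∪ ν) rest \ δ ⊆ ν ∪ (playEnd (δ ∪ ν) rest \ (δ ∪ ν)) := by
      intro p hp
      rw [Finset.mem_sdiff] at hp
      rw [Finset.mem_union, Finset.mem_sdiff, Finset.mem_union]
      by_cases hpν : p ∈ ν
      · exact Or.inl hpν
      · exact Or.inr ⟨hp.1, fun h => h.elim hp.2 hpν⟩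
    calc (playEnd (δ ∪ ν) rest \ δ).card ≤ (ν ∪ (playEnd (δ ∪ ν) rest \ (δ ∪ ν))).card :=
          Finset.card_le_card hsub
      _ ≤ ν.card + (playEnd (δ ∪ ν) rest \ (δ ∪ ν)).card := Finset.card_union_le _ _
      _ ≤ 2 * (crit L δ).card + 2 * playCrit L (δ ∪ ν) rest := Nat.add_le_add hν ih
      _ = 2 * ((crit L δ).card + playCrit L (δ ∪ ν) rest) := by omega

/-- **Divergence**: two finished valid plays from the same position end in equal or
incompatible positions. [cite: Krajicek1995, Lemma 12.3.10 (proof, step 3, Claim (a))] -/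
theorem playEnd_eq_or_not_compat {L : List (Finset (α × β))} {D : Finset α} {R : Finset β} :
    ∀ {δ : Finset (α × β)} {p q : List (Finset (α × β))}, PlayValid L D R δ p → PlayValid L D R δ q →
      crit L (playEnd δ p) = ∅ → crit L (playEnd δ q) = ∅ →
      playEnd δ p = playEnd δ q ∨ ¬ Compat (playEnd δ p) (playEnd δ q)
  | δ, [], q, _, hq, hp0, _ => by
    cases q with
    | nil => exact Or.inl rfl
    | cons ν rest => rw [PlayValid] at hq; exact absurd hp0 hq.1
  | δ, ν :: rest, [], hp, _, _, hq0 => by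
    rw [PlayValid] at hp; exact absurd hq0 hp.1
  | δ, ν :: rest, ν' :: rest', hp, hq, hp0, hq0 => by
    rw [PlayValid] at hp hq
    rw [playEnd, playEnd]
    by_cases hνν : ν = ν'
    · subst hνν
      exact playEnd_eq_or_not_compat hp.2.2 hq.2.2 hp0 hq0
    · right
      intro hc
      exact not_compat_union_of_ne hp.2.1 hq.2.1 hνν
        ((hc.mono_left (subset_playEnd _ _)).mono_right (subset_playEnd _ _))

end Literature.Computability.MetaComplexity.PBij


namespace Literature.Computability.MetaComplexity.PBij

variable {α β : Type*} [DecidableEq α] [DecidableEq β]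

/-! ### Auxiliary matchings between prescribed sets -/

/-- The domain of `insert (a, b) σ`. [folklore] -/
@[simp] theorem dom_insert (a : α) (b : β) (σ : Finset (α × β)) :
    dom (insert (a, b) σ) = insert a (dom σ) := by
  rw [dom, Finset.image_insert]; rfl

/-- The range of `insert (a, b) σ`. [folklore] -/
@[simp] theorem rng_insert (a : α) (b : β) (σ : Finset (α × β)) :
    rng (insert (a, b) σ) = insert b (rng σ) := by
  rw [rng, Finset.image_insert]; rfl

/-- A set `P` of pigeons can be matched injectively into any set `F` of holes with
`|P| ≤ |F|`. [folklore] -/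
theorem exists_matching_left (P : Finset α) (F : Finset β) (h : P.card ≤ F.card) :
    ∃ ν : Finset (α × β), IsPMatching ν ∧ dom ν = P ∧ rng ν ⊆ F := by
  induction P using Finset.induction_on with
  | empty => exact ⟨∅, IsPMatching.empty, rfl, by simp⟩
  | insert a P ha ih =>
    rw [Finset.card_insert_of_notMem ha] at h
    obtain ⟨ν, hν, hdom, hrng⟩ := ih (by omega)
    have hfresh : (F \ rng ν).Nonempty := by
      rw [← Finset.card_pos]
      have h1 := card_le_card_sdiff_add F (rng ν)
      rw [hν.card_rng, ← hν.card_dom, hdom] at h1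
      omega
    obtain ⟨b, hb⟩ := hfresh
    rw [Finset.mem_sdiff] at hb
    refine ⟨insert (a, b) ν, hν.insert (by rw [hdom]; exact ha) hb.2, by rw [dom_insert, hdom], ?_⟩
    rw [rng_insert]
    exact Finset.insert_subset hb.1 hrng

/-- A set `Q` of holes can be matched injectively from any set `F` of pigeons with
`|Q| ≤ |F|`. [folklore] -/
theorem exists_matching_right (F : Finset α) (Q : Finset β) (h : Q.card ≤ F.card) :
    ∃ ν : Finset (α × β), IsPMatching ν ∧ rng ν = Q ∧ dom ν ⊆ F := by
  induction Q using Finset.induction_on with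
  | empty => exact ⟨∅, IsPMatching.empty, rfl, by simp⟩
  | insert b Q hb ih =>
    rw [Finset.card_insert_of_notMem hb] at h
    obtain ⟨ν, hν, hrng, hdom⟩ := ih (by omega)
    have hfresh : (F \ dom ν).Nonempty := by
      rw [← Finset.card_pos]
      have h1 := card_le_card_sdiff_add F (dom ν)
      rw [hν.card_dom, ← hν.card_rng, hrng] at h1
      omega
    obtain ⟨a, ha⟩ := hfresh
    rw [Finset.mem_sdiff] at ha
    refine ⟨insert (a, b) ν, hν.insert ha.2 (by rw [hrng]; exact hb), by rw [rng_insert, hrng], ?_⟩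
    rw [dom_insert]
    exact Finset.insert_subset ha.1 hdom

/-! ### Player II can follow a prescribed matching -/

/-- **Player II can answer consistently with a given matching** `G` compatible with the
position (the strategy "on `supp G` answer according to `G`, otherwise answer with fresh
elements", Krajíček 1995, proof of Lemma 12.3.10, step 3): if `κ` is a matching of fresh
critical pairs and there is room — `|rng δ ∪ rng G| + 2|κ| ≤ |R|` and
`|dom δ ∪ dom G| + 2|κ| ≤ |D|` — then some answer `ν ∈ responses D R δ κ` keeps the new position
`δ ∪ ν` compatible with `G`. [cite: Krajicek1995, Lemma 12.3.10 (proof, step 3)] -/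
theorem exists_response_compat {D : Finset α} {R : Finset β} {δ κ G : Finset (α × β)}
    (hκs : κ ⊆ D ×ˢ R) (hfresh : ∀ p ∈ κ, p.1 ∉ dom δ ∧ p.2 ∉ rng δ) (hGs : G ⊆ D ×ˢ R)
    (hc : Compat δ G) (hroomR : (rng δ ∪ rng G).card + 2 * κ.card ≤ R.card)
    (hroomD : (dom δ ∪ dom G).card + 2 * κ.card ≤ D.card) :
    ∃ ν ∈ responses D R δ κ, Compat (δ ∪ ν) G := by
  -- the part of `G` serving critical pigeons or holes
  set Grel := G.filter fun p => p.1 ∈ dom κ ∨ p.2 ∈ rng κ with hGrel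
  have hGrelG : Grel ⊆ G := Finset.filter_subset _ _
  -- uncovered critical pigeons and holes
  set P := dom κ \ dom G with hP
  set Q := rng κ \ rng G with hQ
  -- free pigeons and holes
  set Rf := R \ (rng δ ∪ rng G ∪ rng κ) with hRf
  set Df := D \ (dom δ ∪ dom G ∪ dom κ) with hDf
  have hPcard : P.card ≤ Rf.card := by
    have h1 := card_le_card_sdiff_add R (rng δ ∪ rng G ∪ rng κ)
    rw [← hRf] at h1
    have h2 := Finset.card_union_le (rng δ ∪ rng G) (rng κ)
    have h3 := card_rng_le κ
    have h4 : P.card ≤ κ.card := (Finset.card_le_card Finset.sdiff_subset).trans (card_dom_le κ)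
    omega
  have hQcard : Q.card ≤ Df.card := by
    have h1 := card_le_card_sdiff_add D (dom δ ∪ dom G ∪ dom κ)
    rw [← hDf] at h1
    have h2 := Finset.card_union_le (dom δ ∪ dom G) (dom κ)
    have h3 := card_dom_le κ
    have h4 : Q.card ≤ κ.card := (Finset.card_le_card Finset.sdiff_subset).trans (card_rng_le κ)
    omega
  obtain ⟨νP, hνP, hνPdom, hνPrng⟩ := exists_matching_left P Rf hPcard
  obtain ⟨νQ, hνQ, hνQrng, hνQdom⟩ := exists_matching_right Df Q hQcard
  -- bookkeeping of coordinates
  have hκdomD : dom κ ⊆ D := dom_subset_of_subset_product hκs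
  have hκrngR : rng κ ⊆ R := rng_subset_of_subset_product hκs
  have hκdomδ : Disjoint (dom κ) (dom δ) := by
    rw [Finset.disjoint_left]; intro a ha
    obtain ⟨b, hb⟩ := mem_dom.1 ha; exact (hfresh _ hb).1
  have hκrngδ : Disjoint (rng κ) (rng δ) := by
    rw [Finset.disjoint_left]; intro b hb
    obtain ⟨a, ha⟩ := mem_rng.1 hb; exact (hfresh _ ha).2
  have hGrel_fresh : ∀ p ∈ Grel, p.1 ∉ dom δ ∧ p.2 ∉ rng δ := by
    intro p hp
    rw [hGrel, Finset.mem_filter] at hp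
    obtain ⟨hpG, hpκ⟩ := hp
    have key : p.1 ∉ dom δ ∨ p.2 ∉ rng δ →  p.1 ∉ dom δ ∧ p.2 ∉ rng δ := by
      intro h
      by_contra hcon
      rw [not_and_or, not_not, not_not] at hcon
      rcases hcon with hd | hr
      · have hpδ : p ∈ δ := hc.symm.mem_of_mem_of_mem_dom hpG hd
        rcases h with h | h
        · exact h hd
        · exact h (mem_rng.2 ⟨p.1, hpδ⟩)
      · have hpδ : p ∈ δ := hc.symm.mem_of_mem_of_mem_rng hpG hr
        rcases h with h | h
        · exact h (mem_dom.2 ⟨p.2, hpδ⟩)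
        · exact h hr
    apply key
    rcases hpκ with h | h
    · exact Or.inl (Finset.disjoint_left.1 hκdomδ h)
    · exact Or.inr (Finset.disjoint_left.1 hκrngδ h)
  have hνPdom_sub : dom νP ⊆ dom κ := by rw [hνPdom]; exact Finset.sdiff_subset
  have hνQrng_sub : rng νQ ⊆ rng κ := by rw [hνQrng]; exact Finset.sdiff_subset
  have hRf_sub : Rf ⊆ R := Finset.sdiff_subset
  have hDf_sub : Df ⊆ D := Finset.sdiff_subset
  have hmemRf : ∀ {b}, b ∈ Rf → b ∉ rng δ ∧ b ∉ rng G ∧ b ∉ rng κ := by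
    intro b hb
    rw [hRf, Finset.mem_sdiff, Finset.mem_union, Finset.mem_union] at hb
    tauto
  have hmemDf : ∀ {a}, a ∈ Df → a ∉ dom δ ∧ a ∉ dom G ∧ a ∉ dom κ := by
    intro a ha
    rw [hDf, Finset.mem_sdiff, Finset.mem_union, Finset.mem_union] at ha
    tauto
  -- `νP ∪ νQ` is a matching with coordinates disjoint from `δ ∪ G`
  have hPQ : IsPMatching (νP ∪ νQ) := by
    refine hνP.union hνQ ?_ ?_
    · rw [Finset.disjoint_left]; intro a ha hq
      exact (hmemDf (hνQdom hq)).2.2 (hνPdom_sub ha)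
    · rw [Finset.disjoint_left]; intro b hb hq
      exact (hmemRf (hνPrng hb)).2.2 (hνQrng_sub hq)
  have hPQdom : Disjoint (dom (δ ∪ G)) (dom (νP ∪ νQ)) := by
    rw [dom_union, dom_union, Finset.disjoint_left]
    intro a ha hb
    rw [Finset.mem_union] at ha hb
    rcases hb with hb | hb
    · have haP : a ∈ P := hνPdom ▸ hb
      rw [hP, Finset.mem_sdiff] at haP
      rcases ha with ha | ha
      · exact Finset.disjoint_left.1 hκdomδ haP.1 ha
      · exact haP.2 ha
    · have := hmemDf (hνQdom hb)
      rcases ha with ha | ha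
      · exact this.1 ha
      · exact this.2.1 ha
  have hPQrng : Disjoint (rng (δ ∪ G)) (rng (νP ∪ νQ)) := by
    rw [rng_union, rng_union, Finset.disjoint_left]
    intro b hb ha
    rw [Finset.mem_union] at ha hb
    rcases ha with ha | ha
    · have := hmemRf (hνPrng ha)
      rcases hb with hb | hb
      · exact this.1 hb
      · exact this.2.1 hb
    · have hbQ : b ∈ Q := hνQrng ▸ ha
      rw [hQ, Finset.mem_sdiff] at hbQ
      rcases hb with hb | hb
      · exact Finset.disjoint_left.1 hκrngδ hbQ.1 hb
      · exact hbQ.2 hb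
  have hbig : IsPMatching ((δ ∪ G) ∪ (νP ∪ νQ)) := IsPMatching.union hc hPQ hPQdom hPQrng
  -- the answer
  refine ⟨Grel ∪ (νP ∪ νQ), mem_responses.2 ⟨?_, ?_, ?_, ?_, ?_⟩, ?_⟩
  · -- inside the fresh part of the universe
    intro p hp
    rw [Finset.mem_product, Finset.mem_sdiff, Finset.mem_sdiff]
    rw [Finset.mem_union, Finset.mem_union] at hp
    rcases hp with hp | hp | hp
    · have hpG := Finset.mem_product.1 (hGs (hGrelG hp))
      exact ⟨⟨hpG.1, (hGrel_fresh p hp).1⟩, hpG.2, (hGrel_fresh p hp).2⟩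
    · have h1 : p.1 ∈ dom κ := hνPdom_sub (mem_dom.2 ⟨p.2, hp⟩)
      have h2 := hmemRf (hνPrng (mem_rng.2 ⟨p.1, hp⟩))
      exact ⟨⟨hκdomD h1, Finset.disjoint_left.1 hκdomδ h1⟩, hRf_sub (hνPrng (mem_rng.2 ⟨p.1, hp⟩)),
        h2.1⟩
    · have h1 := hmemDf (hνQdom (mem_dom.2 ⟨p.2, hp⟩))
      have h2 : p.2 ∈ rng κ := hνQrng_sub (mem_rng.2 ⟨p.1, hp⟩)
      exact ⟨⟨hDf_sub (hνQdom (mem_dom.2 ⟨p.2, hp⟩)), h1.1⟩, hκrngR h2,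
        Finset.disjoint_left.1 hκrngδ h2⟩
  · -- a matching
    exact hbig.subset (Finset.union_subset_union (hGrelG.trans Finset.subset_union_right) le_rfl)
  · -- covers the critical pigeons
    intro a ha
    rw [dom_union, dom_union, Finset.mem_union, Finset.mem_union]
    by_cases haG : a ∈ dom G
    · obtain ⟨b, hb⟩ := mem_dom.1 haG
      exact Or.inl (mem_dom.2 ⟨b, Finset.mem_filter.2 ⟨hb, Or.inl ha⟩⟩)
    · exact Or.inr (Or.inl (by rw [hνPdom, hP, Finset.mem_sdiff]; exact ⟨ha, haG⟩))
  · -- covers the critical holes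
    intro b hb
    rw [rng_union, rng_union, Finset.mem_union, Finset.mem_union]
    by_cases hbG : b ∈ rng G
    · obtain ⟨a, ha⟩ := mem_rng.1 hbG
      exact Or.inl (mem_rng.2 ⟨a, Finset.mem_filter.2 ⟨ha, Or.inr hb⟩⟩)
    · exact Or.inr (Or.inr (by rw [hνQrng, hQ, Finset.mem_sdiff]; exact ⟨hb, hbG⟩))
  · -- minimality
    intro p hp
    rw [Finset.mem_union, Finset.mem_union] at hp
    rcases hp with hp | hp | hp
    · exact (Finset.mem_filter.1 hp).2
    · exact Or.inl (hνPdom_sub (mem_dom.2 ⟨p.2, hp⟩))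
    · exact Or.inr (hνQrng_sub (mem_rng.2 ⟨p.1, hp⟩))
  · -- the new position is compatible with `G`
    refine hbig.subset ?_
    intro p hp
    simp only [Finset.mem_union] at hp ⊢
    rcases hp with (hp | hp | hp | hp) | hp
    · exact Or.inl (Or.inl hp)
    · exact Or.inl (Or.inr (hGrelG hp))
    · exact Or.inr (Or.inl hp)
    · exact Or.inr (Or.inr hp)
    · exact Or.inl (Or.inr hp)

/-! ### The complete system of finished plays -/

/-- The system `S` of Lemma 12.3.10: the final positions `δ ∖ ρ` (over the restricted universe)
of the finished plays from `ρ`. [cite: Krajicek1995, Lemma 12.3.10 (proof, step 3)] -/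
noncomputable def leafSystem (L : List (Finset (α × β))) (D : Finset α) (R : Finset β)
    (ρ : Finset (α × β)) : Finset (Finset (α × β)) := by
  classical
  exact (((D \ dom ρ) ×ˢ (R \ rng ρ)).powerset).filter fun γ =>
    ∃ play, PlayValid L D R ρ play ∧ crit L (playEnd ρ play) = ∅ ∧ playEnd ρ play = ρ ∪ γ

/-- Membership in the leaf system. [cite: Krajicek1995, Lemma 12.3.10 (proof, step 3)] -/
theorem mem_leafSystem {L : List (Finset (α × β))} {D : Finset α} {R : Finset β}
    {ρ γ : Finset (α × β)} :
    γ ∈ leafSystem L D R ρ ↔ γ ⊆ (D \ dom ρ) ×ˢ (R \ rng ρ) ∧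
      ∃ play, PlayValid L D R ρ play ∧ crit L (playEnd ρ play) = ∅ ∧ playEnd ρ play = ρ ∪ γ := by
  classical
  unfold leafSystem
  rw [Finset.mem_filter, Finset.mem_powerset]

/-- A set of fresh pairs is disjoint from `ρ`. [folklore] -/
theorem disjoint_of_subset_restrictedUniverse {D : Finset α} {R : Finset β} {ρ γ : Finset (α × β)}
    (hγ : γ ⊆ (D \ dom ρ) ×ˢ (R \ rng ρ)) : Disjoint ρ γ := by
  rw [Finset.disjoint_right]
  intro p hp hpρ
  have := (Finset.mem_sdiff.1 (Finset.mem_product.1 (hγ hp)).1).2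
  exact this (mem_dom.2 ⟨p.2, hpρ⟩)

/-- For fresh `γ`, `(ρ ∪ γ) ∖ ρ = γ`. [folklore] -/
theorem union_sdiff_of_subset_restrictedUniverse {D : Finset α} {R : Finset β}
    {ρ γ : Finset (α × β)} (hγ : γ ⊆ (D \ dom ρ) ×ˢ (R \ rng ρ)) : (ρ ∪ γ) \ ρ = γ :=
  Finset.union_sdiff_cancel_left (disjoint_of_subset_restrictedUniverse hγ)

/-- **Player II can always finish a play consistently with a small matching** (completeness
of the leaf system, Krajíček 1995, Lemma 12.3.10, step 3, Claim (a), second half): if `ρ` is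
good for `s`, `|R| ≤ |D|`, and `γ` is a matching of the restricted universe with
`|γ| + 2s ≤ |R^ρ|`, some finished play from `ρ` ends in a position compatible with `ρ ∪ γ`.
[cite: Krajicek1995, Lemma 12.3.10 (proof, step 3, Claim (a))] -/
theorem exists_finished_play_compat {L : List (Finset (α × β))} {D : Finset α} {R : Finset β}
    (hL : ∀ h ∈ L, IsPMatching h ∧ h ⊆ D ×ˢ R) (hDR : R.card ≤ D.card) {ρ : Finset (α × β)}
    (hρ : IsPMatching ρ) (hρs : ρ ⊆ D ×ˢ R) {s : ℕ} (hgood : Good L D R ρ s)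
    {γ : Finset (α × β)} (hγ : IsPMatching γ) (hγs : γ ⊆ (D \ dom ρ) ×ˢ (R \ rng ρ))
    (hcard : γ.card + 2 * s ≤ (R \ rng ρ).card) :
    ∃ play, PlayValid L D R ρ play ∧ crit L (playEnd ρ play) = ∅ ∧
      Compat (playEnd ρ play) (ρ ∪ γ) := by
  have hLs : ∀ h ∈ L, h ⊆ D ×ˢ R := fun h hh => (hL h hh).2
  set G := ρ ∪ γ with hGdef
  have hG : IsPMatching G := compat_of_subset_restrictedUniverse hρ hγ hγs
  have hGs : G ⊆ D ×ˢ R := Finset.union_subset hρs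
    (hγs.trans (Finset.product_subset_product Finset.sdiff_subset Finset.sdiff_subset))
  have hRρ := card_restrictedRange hρ hρs (D := D)
  -- strong induction on the number of pairs still available
  suffices key : ∀ (j : ℕ) (pfx : List (Finset (α × β))), PlayValid L D R ρ pfx →
      Compat (playEnd ρ pfx) G → (D ×ˢ R).card + 1 - (playEnd ρ pfx).card = j →
      ∃ play, PlayValid L D R ρ play ∧ crit L (playEnd ρ play) = ∅ ∧
        Compat (playEnd ρ play) G from
    key _ [] trivial (hG.compat_of_subset Finset.subset_union_left) rfl
  intro j
  induction j using Nat.strong_induction_on with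
  | _ j ih =>
    intro pfx hpfx hc hj
    set δ := playEnd ρ pfx with hδdef
    obtain ⟨hδ, hδs⟩ : IsPMatching δ ∧ δ ⊆ D ×ˢ R := playEnd_invariant hpfx hρ hρs
    by_cases hterm : crit L δ = ∅
    · exact ⟨pfx, hpfx, hterm, hc⟩
    -- one more round, answered consistently with `G`
    have hgood' := hgood pfx hpfx
    rw [← hδdef] at hgood'
    have hsd := card_playEnd_sdiff_le hpfx
    rw [← hδdef] at hsd
    have hκfresh : ∀ p ∈ crit L δ, p.1 ∉ dom δ ∧ p.2 ∉ rng δ := fun p hp => crit_fresh hp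
    have hδρ : δ = ρ ∪ (δ \ ρ) := (Finset.union_sdiff_of_subset (subset_playEnd ρ pfx)).symm
    have hrng : (rng δ ∪ rng G).card ≤ ρ.card + (δ \ ρ).card + γ.card := by
      have e : rng δ ∪ rng G = rng ρ ∪ rng (δ \ ρ) ∪ rng γ := by
        conv_lhs => rw [hδρ, hGdef, rng_union, rng_union]
        ext b; simp only [Finset.mem_union]; tauto
      rw [e]
      calc (rng ρ ∪ rng (δ \ ρ) ∪ rng γ).card ≤ (rng ρ ∪ rng (δ \ ρ)).card + (rng γ).card :=
            Finset.card_union_le _ _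
        _ ≤ (rng ρ).card + (rng (δ \ ρ)).card + (rng γ).card :=
            Nat.add_le_add_right (Finset.card_union_le _ _) _
        _ ≤ ρ.card + (δ \ ρ).card + γ.card :=
            Nat.add_le_add (Nat.add_le_add (card_rng_le _) (card_rng_le _)) (card_rng_le _)
    have hdom : (dom δ ∪ dom G).card ≤ ρ.card + (δ \ ρ).card + γ.card := by
      have e : dom δ ∪ dom G = dom ρ ∪ dom (δ \ ρ) ∪ dom γ := by
        conv_lhs => rw [hδρ, hGdef, dom_union, dom_union]
        ext a; simp only [Finset.mem_union]; tauto
      rw [e]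
      calc (dom ρ ∪ dom (δ \ ρ) ∪ dom γ).card ≤ (dom ρ ∪ dom (δ \ ρ)).card + (dom γ).card :=
            Finset.card_union_le _ _
        _ ≤ (dom ρ).card + (dom (δ \ ρ)).card + (dom γ).card :=
            Nat.add_le_add_right (Finset.card_union_le _ _) _
        _ ≤ ρ.card + (δ \ ρ).card + γ.card :=
            Nat.add_le_add (Nat.add_le_add (card_dom_le _) (card_dom_le _)) (card_dom_le _)
    obtain ⟨ν, hν, hcν⟩ := exists_response_compat (crit_subset_universe hLs δ) hκfresh hGs hc
      (by omega) (by omega)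
    -- the extended play
    have hpfx' : PlayValid L D R ρ (pfx ++ [ν]) := by
      rw [playValid_append]; exact ⟨hpfx, hterm, hν, trivial⟩
    have hend' : playEnd ρ (pfx ++ [ν]) = δ ∪ ν := by rw [playEnd_append]; rfl
    have hlt : δ.card < (δ ∪ ν).card := by
      rw [Finset.card_union_of_disjoint (disjoint_response hν)]
      have := (response_nonempty hν hterm).card_pos
      omega
    have hbound : (δ ∪ ν).card ≤ (D ×ˢ R).card :=
      Finset.card_le_card (Finset.union_subset hδs (response_subset_universe hν))
    exact ih ((D ×ˢ R).card + 1 - (δ ∪ ν).card) (by omega) (pfx ++ [ν]) hpfx'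
      (by rw [hend']; exact hcν) (by rw [hend'])

/-- **The leaf system is `2s`-complete** over the restricted universe when `ρ` is good for `s`
(Krajíček 1995, Lemma 12.3.10, proof, step 3, Claim (a), with the norm bound of step 6).
[cite: Krajicek1995, Lemma 12.3.10 (proof, Claim (a) and step 6)] -/
theorem isKComplete_leafSystem {L : List (Finset (α × β))} {D : Finset α} {R : Finset β}
    (hL : ∀ h ∈ L, IsPMatching h ∧ h ⊆ D ×ˢ R) (hDR : R.card ≤ D.card) {ρ : Finset (α × β)}
    (hρ : IsPMatching ρ) (hρs : ρ ⊆ D ×ˢ R) {s : ℕ} (hgood : Good L D R ρ s) :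
    IsKComplete (D \ dom ρ) (R \ rng ρ) (2 * s) (leafSystem L D R ρ) where
  isPMatching γ hγ := by
    obtain ⟨-, play, hv, -, hend⟩ := mem_leafSystem.1 hγ
    exact (playEnd_invariant hv hρ hρs).1.subset (hend ▸ Finset.subset_union_right)
  subset γ hγ := (mem_leafSystem.1 hγ).1
  card_le γ hγ := by
    obtain ⟨hγs, play, hv, hterm, hend⟩ := mem_leafSystem.1 hγ
    have h1 := card_playEnd_sdiff_le hv
    have h2 := hgood play hv
    rw [hterm, Finset.card_empty, Nat.add_zero] at h2
    rw [hend, union_sdiff_of_subset_restrictedUniverse hγs] at h1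
    omega
  eq_of_compat γ₁ hγ₁ γ₂ hγ₂ hc := by
    obtain ⟨hγ₁s, p, hp, hpt, hpe⟩ := mem_leafSystem.1 hγ₁
    obtain ⟨hγ₂s, q, hq, hqt, hqe⟩ := mem_leafSystem.1 hγ₂
    rcases playEnd_eq_or_not_compat hp hq hpt hqt with h | h
    · rw [hpe, hqe] at h
      rw [← union_sdiff_of_subset_restrictedUniverse hγ₁s, h,
        union_sdiff_of_subset_restrictedUniverse hγ₂s]
    · exfalso
      apply h
      rw [hpe, hqe]
      have h1 : IsPMatching (ρ ∪ γ₁) := hpe ▸ (playEnd_invariant hp hρ hρs).1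
      have h2 : IsPMatching (ρ ∪ γ₂) := hqe ▸ (playEnd_invariant hq hρ hρs).1
      rw [← compat_sdiff_iff (h1.compat_of_subset Finset.subset_union_left)
        (h2.compat_of_subset Finset.subset_union_left),
        union_sdiff_of_subset_restrictedUniverse hγ₁s, union_sdiff_of_subset_restrictedUniverse hγ₂s]
      exact hc
  exists_compat γ hγ hγs hcard := by
    obtain ⟨play, hv, hterm, hc⟩ := exists_finished_play_compat hL hDR hρ hρs hgood hγ hγs hcard
    obtain ⟨hend, hends⟩ := playEnd_invariant hv hρ hρs
    have hρend : ρ ⊆ playEnd ρ play := subset_playEnd ρ play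
    refine ⟨playEnd ρ play \ ρ, mem_leafSystem.2 ⟨?_, play, hv, hterm, ?_⟩, ?_⟩
    · exact sdiff_subset_restrictedUniverse hends (hend.compat_of_subset hρend)
    · rw [Finset.union_sdiff_of_subset hρend]
    · exact (hc.mono_left Finset.sdiff_subset).mono_right Finset.subset_union_right

/-- **The leaf system refines `H^ρ`** (Krajíček 1995, Lemma 12.3.10, proof, step 3,
Claim (b)): a finished position compatible with some `h ∈ H` compatible with `ρ` contains the
first such `h` (the play stopped because player I's move was already inside the position).
[cite: Krajicek1995, Lemma 12.3.10 (proof, Claim (b))] -/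
theorem refines_leafSystem {L : List (Finset (α × β))} {D : Finset α} {R : Finset β}
    {ρ : Finset (α × β)} (hρ : IsPMatching ρ) (hρs : ρ ⊆ D ×ˢ R) : Refines (restrict ρ L.toFinset) (leafSystem L D R ρ) := by
  rintro γ hγ ⟨η, hη, hc⟩
  obtain ⟨hγs, play, hv, hterm, hend⟩ := mem_leafSystem.1 hγ
  obtain ⟨h, hh, hρh, rfl⟩ := mem_restrict.1 hη
  have hmatch : IsPMatching (ρ ∪ γ) := hend ▸ (playEnd_invariant hv hρ hρs).1
  have hρ' : Compat ρ (ρ ∪ γ) := hmatch.compat_of_subset Finset.subset_union_left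
  have hcomp : Compat h (ρ ∪ γ) := by
    rw [← compat_sdiff_iff hρh hρ', union_sdiff_of_subset_restrictedUniverse hγs]; exact hc
  cases hf : firstCompat L (playEnd ρ play) with
  | none =>
    rw [firstCompat_eq_none] at hf
    exact absurd (hend ▸ hcomp) (hf h (List.mem_toFinset.1 hh))
  | some h₀ =>
    have h₀sub : h₀ ⊆ ρ ∪ γ := by
      rw [crit_eq_of_some hf, Finset.sdiff_eq_empty_iff_subset, hend] at hterm; exact hterm
    have h₀L : h₀ ∈ L := (firstCompat_spec hf).1
    have hρh₀ : Compat ρ h₀ := hmatch.compat_of_subset_of_subset Finset.subset_union_left h₀sub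
    refine ⟨h₀ \ ρ, sdiff_mem_restrict (List.mem_toFinset.2 h₀L) hρh₀, ?_⟩
    rw [← union_sdiff_of_subset_restrictedUniverse hγs]
    exact Finset.sdiff_subset_sdiff h₀sub le_rfl

end Literature.Computability.MetaComplexity.PBij


namespace Literature.Computability.MetaComplexity.PBij

variable {α β : Type*} [DecidableEq α] [DecidableEq β]

/-! ### Coding finite data by numbers

The coding argument of Lemma 12.3.10 (steps 7–12) codes elements of known finite sets by
their index in a fixed enumeration; we use `Finset.equivFin`. -/

section Indexing

variable {γ : Type*} [DecidableEq γ]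

/-- The index of `x` in the fixed enumeration of `s` (junk `0` if `x ∉ s`). [folklore] -/
noncomputable def idxOf (s : Finset γ) (x : γ) : ℕ :=
  if h : x ∈ s then (s.equivFin ⟨x, h⟩ : ℕ) else 0

/-- The element of `s` with index `i` (if any). [folklore] -/
noncomputable def nthOf (s : Finset γ) (i : ℕ) : Option γ :=
  if h : i < s.card then some (s.equivFin.symm ⟨i, h⟩ : s) else none

/-- Indices are below the cardinality. [folklore] -/
theorem idxOf_lt_card {s : Finset γ} {x : γ} (hx : x ∈ s) : idxOf s x < s.card := by
  unfold idxOf; rw [dif_pos hx]; exact Fin.is_lt _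

/-- Indices are below the cardinality, or the set is empty and the index is `0`. [folklore] -/
theorem idxOf_lt_succ_card (s : Finset γ) (x : γ) : idxOf s x < s.card + 1 := by
  unfold idxOf; split_ifs
  · exact Nat.lt_succ_of_lt (Fin.is_lt _)
  · exact Nat.succ_pos _

/-- Decoding the index recovers the element. [folklore] -/
theorem nthOf_idxOf {s : Finset γ} {x : γ} (hx : x ∈ s) : nthOf s (idxOf s x) = some x := by
  unfold nthOf idxOf
  rw [dif_pos hx, dif_pos (Fin.is_lt _)]
  simp

/-- The index of an optional element (junk `0` for `none`). [folklore] -/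
noncomputable def oidxOf (s : Finset γ) : Option γ → ℕ
  | none => 0
  | some x => idxOf s x

/-- Indices of optional elements are below the cardinality plus one. [folklore] -/
theorem oidxOf_lt_succ_card (s : Finset γ) (o : Option γ) : oidxOf s o < s.card + 1 := by
  cases o with
  | none => exact Nat.succ_pos _
  | some x => exact idxOf_lt_succ_card s x

end Indexing

/-- The value of a matching at a pigeon of its domain (as an option). [folklore] -/
noncomputable def valOf (ν : Finset (α × β)) (a : α) : Option β :=
  if h : a ∈ dom ν then some (Classical.choose (mem_dom.1 h)) else none

/-- The preimage of a hole of the range of a matching (as an option). [folklore] -/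
noncomputable def invOf (ν : Finset (α × β)) (b : β) : Option α :=
  if h : b ∈ rng ν then some (Classical.choose (mem_rng.1 h)) else none

omit [DecidableEq β] in
/-- Specification of `valOf` for matchings. [folklore] -/
theorem valOf_eq_some_iff {ν : Finset (α × β)} (hν : IsPMatching ν) {a : α} {b : β} :
    valOf ν a = some b ↔ (a, b) ∈ ν := by
  unfold valOf
  split_ifs with h
  · have hspec := Classical.choose_spec (mem_dom.1 h)
    rw [Option.some.injEq]
    exact ⟨fun hb => hb ▸ hspec, fun hb => hν.eq_of_fst_eq hspec hb⟩
  · simp only [false_iff]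
    exact fun hb => h (mem_dom.2 ⟨b, hb⟩)

omit [DecidableEq α] in
/-- Specification of `invOf` for matchings. [folklore] -/
theorem invOf_eq_some_iff {ν : Finset (α × β)} (hν : IsPMatching ν) {a : α} {b : β} :
    invOf ν b = some a ↔ (a, b) ∈ ν := by
  unfold invOf
  split_ifs with h
  · have hspec := Classical.choose_spec (mem_rng.1 h)
    rw [Option.some.injEq]
    exact ⟨fun ha => ha ▸ hspec, fun ha => hν.eq_of_snd_eq hspec ha⟩
  · simp only [false_iff]
    exact fun ha => h (mem_rng.2 ⟨a, ha⟩)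

/-! ### The critical sets of a play and the matchings `τ` of the coding argument -/

/-- The union of the critical sets met along a play. [cite: Krajicek1995, Lemma 12.3.10 (proof, step 8)] -/
def critUnion (L : List (Finset (α × β))) : Finset (α × β) → List (Finset (α × β)) → Finset (α × β)
  | _, [] => ∅
  | δ, ν :: rest => crit L δ ∪ critUnion L (δ ∪ ν) rest

/-- The matching `τ` of the coding argument seen from position `δ` with the remaining play
`pfx` and the final (truncated) critical set `extra`: the position together with all later
critical pairs. For `δ = ρ` this is Krajíček's `τ = ρ ∪ {first s critical pairs}`; for the
intermediate positions these are the `τ_i` of step 12. [cite: Krajicek1995, Lemma 12.3.10 (proof, steps 8 and 12)] -/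
def tauSet (L : List (Finset (α × β))) (δ : Finset (α × β)) (pfx : List (Finset (α × β)))
    (extra : Finset (α × β)) : Finset (α × β) :=
  δ ∪ critUnion L δ pfx ∪ extra

/-- Later critical pairs are fresh with respect to the current position. [cite: Krajicek1995, Lemma 12.3.10 (proof, step 8: τ ∈ 𝓜)] -/
theorem critUnion_fresh {L : List (Finset (α × β))} {D : Finset α} {R : Finset β} :
    ∀ {δ : Finset (α × β)} {pfx : List (Finset (α × β))}, PlayValid L D R δ pfx →
      ∀ p ∈ critUnion L δ pfx, p.1 ∉ dom δ ∧ p.2 ∉ rng δ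
  | _, [], _, p, hp => absurd hp (Finset.notMem_empty p)
  | δ, ν :: rest, hv, p, hp => by
    rw [PlayValid] at hv
    rw [critUnion, Finset.mem_union] at hp
    rcases hp with hp | hp
    · exact crit_fresh hp
    · have := critUnion_fresh hv.2.2 p hp
      rw [dom_union, rng_union, Finset.mem_union, Finset.mem_union, not_or, not_or] at this
      exact ⟨this.1.1, this.2.1⟩

/-- The critical set of a round is disjoint from the later critical pairs. [folklore] -/
theorem disjoint_crit_critUnion {L : List (Finset (α × β))} {D : Finset α} {R : Finset β}
    {δ ν : Finset (α × β)} {rest : List (Finset (α × β))} (hν : ν ∈ responses D R δ (crit L δ))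
    (hrest : PlayValid L D R (δ ∪ ν) rest) : Disjoint (crit L δ) (critUnion L (δ ∪ ν) rest) := by
  rw [Finset.disjoint_left]
  intro p hpκ hpu
  have h1 : p.1 ∈ dom (δ ∪ ν) := by
    rw [dom_union]; exact Finset.mem_union_right _ ((mem_responses.1 hν).2.2.1 (mem_dom.2 ⟨p.2, hpκ⟩))
  exact (critUnion_fresh hrest p hpu).1 h1

/-- The number of critical pairs met is the sum of the sizes of the critical sets.
[cite: Krajicek1995, Lemma 12.3.10 (proof, step 8: |τ| = w + s)] -/
theorem card_critUnion {L : List (Finset (α × β))} {D : Finset α} {R : Finset β} :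
    ∀ {δ : Finset (α × β)} {pfx : List (Finset (α × β))}, PlayValid L D R δ pfx →
      (critUnion L δ pfx).card = playCrit L δ pfx
  | _, [], _ => rfl
  | δ, ν :: rest, hv => by
    rw [PlayValid] at hv
    rw [critUnion, playCrit, Finset.card_union_of_disjoint (disjoint_crit_critUnion hv.2.1 hv.2.2),
      card_critUnion hv.2.2]

/-- The later critical pairs lie in the universe. [folklore] -/
theorem critUnion_subset_universe {L : List (Finset (α × β))} {D : Finset α} {R : Finset β}
    (hL : ∀ h ∈ L, h ⊆ D ×ˢ R) : ∀ (δ : Finset (α × β)) (pfx : List (Finset (α × β))),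
      critUnion L δ pfx ⊆ D ×ˢ R
  | _, [] => Finset.empty_subset _
  | δ, ν :: rest => Finset.union_subset (crit_subset_universe hL δ)
      (critUnion_subset_universe hL (δ ∪ ν) rest)

/-- Player I's move has all its pigeons and holes inside the next position.
[cite: Krajicek1995, Lemma 12.3.10 (proof, step 2(b))] -/
theorem move_subset_next {L : List (Finset (α × β))} {D : Finset α} {R : Finset β}
    {δ ν h : Finset (α × β)} (hf : firstCompat L δ = some h) (hν : ν ∈ responses D R δ (crit L δ)) :
    dom h ⊆ dom (δ ∪ ν) ∧ rng h ⊆ rng (δ ∪ ν) := by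
  have hκ := crit_eq_of_some hf
  obtain ⟨-, -, hdom, hrng, -⟩ := mem_responses.1 hν
  rw [dom_union, rng_union]
  constructor
  · intro a ha
    obtain ⟨b, hb⟩ := mem_dom.1 ha
    by_cases hm : (a, b) ∈ δ
    · exact Finset.mem_union_left _ (mem_dom.2 ⟨b, hm⟩)
    · exact Finset.mem_union_right _ (hdom (mem_dom.2 ⟨b, by rw [hκ, Finset.mem_sdiff]; exact ⟨hb, hm⟩⟩))
  · intro b hb
    obtain ⟨a, ha⟩ := mem_rng.1 hb
    by_cases hm : (a, b) ∈ δ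
    · exact Finset.mem_union_left _ (mem_rng.2 ⟨a, hm⟩)
    · exact Finset.mem_union_right _ (hrng (mem_rng.2 ⟨a, by rw [hκ, Finset.mem_sdiff]; exact ⟨ha, hm⟩⟩))

/-- **`τ` is a matching** (Krajíček 1995, Lemma 12.3.10, step 8: "Hence `τ ∈ 𝓜`"), in the
form needed at every stage of the decoding. [cite: Krajicek1995, Lemma 12.3.10 (proof, step 8)] -/
theorem isPMatching_tauSet {L : List (Finset (α × β))} {D : Finset α} {R : Finset β}
    (hL : ∀ h ∈ L, IsPMatching h) :
    ∀ {δ : Finset (α × β)} {pfx : List (Finset (α × β))} {extra : Finset (α × β)},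
      PlayValid L D R δ pfx → IsPMatching δ → extra ⊆ crit L (playEnd δ pfx) →
      IsPMatching (tauSet L δ pfx extra)
  | δ, [], extra, _, hδ, hextra => by
    rw [tauSet, critUnion, Finset.union_empty, playEnd] at *
    by_cases hne : crit L δ = ∅
    · rw [hne, Finset.subset_empty] at hextra; rw [hextra, Finset.union_empty]; exact hδ
    · obtain ⟨h, hf, hκ, -⟩ := exists_of_crit_ne_empty hne
      have hc := (firstCompat_spec hf).2
      exact hc.symm.subset (Finset.union_subset_union le_rfl (hextra.trans (hκ ▸ Finset.sdiff_subset)))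
  | δ, ν :: rest, extra, hv, hδ, hextra => by
    rw [PlayValid] at hv
    rw [playEnd] at hextra
    have ih := isPMatching_tauSet hL hv.2.2 (isPMatching_union_response hδ hv.2.1) hextra
    obtain ⟨h, hf, hκ, -⟩ := exists_of_crit_ne_empty hv.1
    have hc := (firstCompat_spec hf).2
    -- `τ = (δ ∪ later ∪ extra) ∪ κ`, the first part inside the matching `tauSet (δ ∪ ν) rest extra`
    have hsub : δ ∪ critUnion L (δ ∪ ν) rest ∪ extra ⊆ tauSet L (δ ∪ ν) rest extra := by
      unfold tauSet
      exact Finset.union_subset_union (Finset.union_subset_union Finset.subset_union_left le_rfl) le_rfl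
    have hpart : IsPMatching (δ ∪ critUnion L (δ ∪ ν) rest ∪ extra) := ih.subset hsub
    have hfreshL : ∀ p ∈ critUnion L (δ ∪ ν) rest ∪ extra, p.1 ∉ dom (δ ∪ ν) ∧ p.2 ∉ rng (δ ∪ ν) := by
      intro p hp
      rw [Finset.mem_union] at hp
      rcases hp with hp | hp
      · exact critUnion_fresh hv.2.2 p hp
      · have := crit_fresh (hextra hp)
        exact ⟨fun h1 => this.1 (dom_mono (subset_playEnd _ _) h1),
          fun h2 => this.2 (rng_mono (subset_playEnd _ _) h2)⟩
    have hmove := move_subset_next hf hv.2.1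
    have key : tauSet L δ (ν :: rest) extra = (δ ∪ critUnion L (δ ∪ ν) rest ∪ extra) ∪ crit L δ := by
      unfold tauSet; rw [critUnion]; ext p; simp only [Finset.mem_union]; tauto
    rw [key, ← Compat, compat_comm, compat_iff]
    refine ⟨(isPMatching_crit hL δ), hpart, fun p hp q hq hpq => ?_⟩
    rw [hκ, Finset.mem_sdiff] at hp
    rw [Finset.union_assoc, Finset.mem_union] at hq
    rcases hq with hq | hq
    · exact (compat_iff.1 hc).2.2 p hp.1 q hq hpq
    · exfalso
      have hq' := hfreshL q hq
      rcases hpq with h1 | h2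
      · exact hq'.1 (hmove.1 (mem_dom.2 ⟨p.2, h1 ▸ hp.1⟩))
      · exact hq'.2 (hmove.2 (mem_rng.2 ⟨p.1, h2 ▸ hp.1⟩))

/-- **Player I's move is compatible with `τ`** (the heart of step 12 of the proof of
Lemma 12.3.10: "`τ_i` determines `h_i` as the first `h` consistent with it"): the move `h` at
`δ` is compatible with `tauSet L δ pfx extra`. [cite: Krajicek1995, Lemma 12.3.10 (proof, step 12)] -/
theorem compat_move_tauSet {L : List (Finset (α × β))} {D : Finset α} {R : Finset β}
    (hL : ∀ h ∈ L, IsPMatching h) {δ : Finset (α × β)} {pfx : List (Finset (α × β))}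
    {extra h : Finset (α × β)} (hv : PlayValid L D R δ pfx) (hδ : IsPMatching δ)
    (hextra : extra ⊆ crit L (playEnd δ pfx)) (hf : firstCompat L δ = some h) :
    Compat h (tauSet L δ pfx extra) := by
  have hc := (firstCompat_spec hf).2
  cases pfx with
  | nil =>
    rw [playEnd] at hextra
    rw [tauSet, critUnion, Finset.union_empty]
    refine hc.subset ?_
    rw [crit_eq_of_some hf] at hextra
    intro p hp
    simp only [Finset.mem_union] at hp ⊢
    rcases hp with hp | hp | hp
    · exact Or.inl hp
    · exact Or.inr hp
    · exact Or.inl (Finset.mem_sdiff.1 (hextra hp)).1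
  | cons ν rest =>
    have hτ := isPMatching_tauSet hL hv hδ hextra
    rw [PlayValid] at hv
    rw [playEnd] at hextra
    have hmove := move_subset_next hf hv.2.1
    have hfreshL : ∀ p ∈ critUnion L (δ ∪ ν) rest ∪ extra, p.1 ∉ dom (δ ∪ ν) ∧ p.2 ∉ rng (δ ∪ ν) := by
      intro p hp
      rw [Finset.mem_union] at hp
      rcases hp with hp | hp
      · exact critUnion_fresh hv.2.2 p hp
      · have := crit_fresh (hextra hp)
        exact ⟨fun h1 => this.1 (dom_mono (subset_playEnd _ _) h1),
          fun h2 => this.2 (rng_mono (subset_playEnd _ _) h2)⟩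
    rw [compat_iff]
    refine ⟨hc.left, hτ, fun p hp q hq hpq => ?_⟩
    rw [tauSet, critUnion, Finset.union_assoc, Finset.union_assoc, Finset.mem_union,
      Finset.mem_union] at hq
    rcases hq with hq | hq | hq
    · exact (compat_iff.1 hc).2.2 p hp q hq hpq
    · rw [crit_eq_of_some hf, Finset.mem_sdiff] at hq
      exact hc.left p hp q hq.1 hpq
    · exfalso
      have hq' := hfreshL q hq
      rcases hpq with h1 | h2
      · exact hq'.1 (hmove.1 (mem_dom.2 ⟨p.2, h1 ▸ hp⟩))
      · exact hq'.2 (hmove.2 (mem_rng.2 ⟨p.1, h2 ▸ hp⟩))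

/-- Consequently player I's move at `δ` is also its move at `τ`. [cite: Krajicek1995, Lemma 12.3.10 (proof, step 12(a))] -/
theorem firstCompat_tauSet {L : List (Finset (α × β))} {D : Finset α} {R : Finset β}
    (hL : ∀ h ∈ L, IsPMatching h) {δ : Finset (α × β)} {pfx : List (Finset (α × β))}
    {extra h : Finset (α × β)} (hv : PlayValid L D R δ pfx) (hδ : IsPMatching δ)
    (hextra : extra ⊆ crit L (playEnd δ pfx)) (hf : firstCompat L δ = some h) :
    firstCompat L (tauSet L δ pfx extra) = some h :=
  firstCompat_of_subset hf (by unfold tauSet; rw [Finset.union_assoc]; exact Finset.subset_union_left)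
    (compat_move_tauSet hL hv hδ hextra hf)

/-- Passing to the next round: removing the critical pairs of the round from `τ` and adding
player II's answer gives the `τ` of the next position (Krajíček's `τ_{i+1} := δ_i ∪ (τ_i ∖ κ_i)`).
[cite: Krajicek1995, Lemma 12.3.10 (proof, step 12(b))] -/
theorem tauSet_next {L : List (Finset (α × β))} {D : Finset α} {R : Finset β}
    {δ ν : Finset (α × β)} {rest : List (Finset (α × β))} {extra : Finset (α × β)}
    (hv : PlayValid L D R δ (ν :: rest)) (hextra : extra ⊆ crit L (playEnd δ (ν :: rest))) :
    (tauSet L δ (ν :: rest) extra \ crit L δ) ∪ ν = tauSet L (δ ∪ ν) rest extra := by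
  rw [PlayValid] at hv
  rw [playEnd] at hextra
  obtain ⟨h, hf, hκ, -⟩ := exists_of_crit_ne_empty hv.1
  have hdisj1 : ∀ p ∈ crit L δ, p ∉ δ := fun p hp => by
    rw [hκ, Finset.mem_sdiff] at hp; exact hp.2
  have hdisj2 : ∀ p ∈ crit L δ, p ∉ critUnion L (δ ∪ ν) rest := fun p hp hq =>
    Finset.disjoint_left.1 (disjoint_crit_critUnion hv.2.1 hv.2.2) hp hq
  have hdisj3 : ∀ p ∈ crit L δ, p ∉ extra := fun p hp hq => by
    have h1 : p.1 ∈ dom (δ ∪ ν) := by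
      rw [dom_union]
      exact Finset.mem_union_right _ ((mem_responses.1 hv.2.1).2.2.1 (mem_dom.2 ⟨p.2, hp⟩))
    exact (crit_fresh (hextra hq)).1 (dom_mono (subset_playEnd _ _) h1)
  ext p
  simp only [tauSet, critUnion, Finset.mem_union, Finset.mem_sdiff]
  constructor
  · rintro (⟨((hp | hp | hp) | hp), hpκ⟩ | hp)
    · exact Or.inl (Or.inl (Or.inl hp))
    · exact absurd hp hpκ
    · exact Or.inl (Or.inr hp)
    · exact Or.inr hp
    · exact Or.inl (Or.inl (Or.inr hp))
  · rintro (((hp | hp) | hp) | hp)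
    · exact Or.inl ⟨Or.inl (Or.inl hp), fun hκ => hdisj1 p hκ hp⟩
    · exact Or.inr hp
    · exact Or.inl ⟨Or.inl (Or.inr (Or.inr hp)), fun hκ => hdisj2 p hκ hp⟩
    · exact Or.inl ⟨Or.inr hp, fun hκ => hdisj3 p hκ hp⟩

end Literature.Computability.MetaComplexity.PBij


namespace Literature.Computability.MetaComplexity.PBij

variable {α β : Type*} [DecidableEq α] [DecidableEq β]

/-! ### The code of a bad play (Krajíček 1995, Lemma 12.3.10, steps 7–11)

A critical pair `p` of a round with move `h`, critical set `κ`, answer `ν` and coding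
matching `τ` is coded by three numbers: the index of `p` in `h`, the index of the value
`ν(p.1)` in the set `(R ∖ rng τ) ∪ rng κ` and the index of the preimage `ν⁻¹(p.2)` in
`(D ∖ dom τ) ∪ dom κ` (both sets are known to the decoder at that stage and contain the
value resp. preimage); the last pair of a round carries a mark. -/

/-- A code entry: index of the critical pair in player I's move, index of player II's value,
index of player II's preimage. [cite: Krajicek1995, Lemma 12.3.10 (proof, steps 7, 9, 10)] -/
abbrev Entry := ℕ × ℕ × ℕ

/-- Mark the last entry of a round. [folklore] -/
def markLast : List Entry → List (Entry × Bool)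
  | [] => []
  | [e] => [(e, true)]
  | e :: e' :: l => (e, false) :: markLast (e' :: l)

/-- Split off the first round of a code (up to and including the first marked entry).
[folklore] -/
def splitRound : List (Entry × Bool) → List Entry × List (Entry × Bool)
  | [] => ([], [])
  | (e, true) :: rest => ([e], rest)
  | (e, false) :: rest => (e :: (splitRound rest).1, (splitRound rest).2)

omit [DecidableEq α] [DecidableEq β] in
/-- Splitting recovers a marked round. [folklore] -/
theorem splitRound_markLast_append : ∀ {l : List Entry}, l ≠ [] → ∀ rest : List (Entry × Bool),
    splitRound (markLast l ++ rest) = (l, rest)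
  | [_], _, _ => rfl
  | e :: e' :: l, _, rest => by
    rw [markLast, List.cons_append, splitRound, splitRound_markLast_append (List.cons_ne_nil e' l) rest]

omit [DecidableEq α] [DecidableEq β] in
/-- Marking preserves the length. [folklore] -/
theorem length_markLast : ∀ l : List Entry, (markLast l).length = l.length
  | [] => rfl
  | [_] => rfl
  | e :: e' :: l => by simp [markLast, length_markLast (e' :: l)]

omit [DecidableEq α] [DecidableEq β] in
/-- Entries of a marked list are entries of the list. [folklore] -/
theorem fst_mem_of_mem_markLast : ∀ {l : List Entry} {x : Entry × Bool}, x ∈ markLast l → x.1 ∈ l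
  | [], _, hx => absurd hx List.not_mem_nil
  | [e], x, hx => by simp [markLast] at hx; subst hx; simp
  | e :: e' :: l, x, hx => by
    rw [markLast, List.mem_cons] at hx
    rcases hx with rfl | hx
    · exact List.mem_cons_self ..
    · exact List.mem_cons_of_mem _ (fst_mem_of_mem_markLast hx)

omit [DecidableEq α] [DecidableEq β] in
/-- A marked nonempty list is nonempty, with an explicit head. [folklore] -/
theorem exists_markLast_eq_cons {l : List Entry} (hl : l ≠ []) (rest : List (Entry × Bool)) :
    ∃ e code, markLast l ++ rest = e :: code := by
  match l, hl with
  | [e], _ => exact ⟨(e, true), rest, rfl⟩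
  | e :: e' :: l, _ => exact ⟨(e, false), markLast (e' :: l) ++ rest, rfl⟩

/-- The value set known to the decoder: holes free in `τ` or critical in the round.
[cite: Krajicek1995, Lemma 12.3.10 (proof, step 9)] -/
def holesFor (R : Finset β) (τ κ : Finset (α × β)) : Finset β :=
  (R \ rng τ) ∪ rng κ

/-- The preimage set known to the decoder: pigeons free in `τ` or critical in the round.
[cite: Krajicek1995, Lemma 12.3.10 (proof, step 9)] -/
def pigeonsFor (D : Finset α) (τ κ : Finset (α × β)) : Finset α :=
  (D \ dom τ) ∪ dom κ

/-- The code of one round: for each critical pair, its index in the move `h`, the index of its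
pigeon's value under the answer `ν`, and the index of its hole's preimage.
[cite: Krajicek1995, Lemma 12.3.10 (proof, steps 7, 9)] -/
noncomputable def encRound (D : Finset α) (R : Finset β) (h κ ν τ : Finset (α × β)) : List Entry :=
  κ.toList.map fun p =>
    (idxOf h p, oidxOf (holesFor R τ κ) (valOf ν p.1), oidxOf (pigeonsFor D τ κ) (invOf ν p.2))

/-- The code of the full rounds of a play from `δ` (the final truncated critical set `extra`
enters through the coding matchings `τ`). [cite: Krajicek1995, Lemma 12.3.10 (proof, step 10)] -/
noncomputable def encRounds (L : List (Finset (α × β))) (D : Finset α) (R : Finset β) :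
    Finset (α × β) → List (Finset (α × β)) → Finset (α × β) → List (Entry × Bool)
  | _, [], _ => []
  | δ, ν :: rest, extra =>
    markLast (encRound D R ((firstCompat L δ).getD ∅) (crit L δ) ν (tauSet L δ (ν :: rest) extra)) ++
      encRounds L D R (δ ∪ ν) rest extra

/-- The code of the final truncated round: only the indices of the critical pairs.
[cite: Krajicek1995, Lemma 12.3.10 (proof, step 6: the set T_{k+1})] -/
noncomputable def encLast (L : List (Finset (α × β))) (δ extra : Finset (α × β)) : List (Entry × Bool) :=
  markLast (extra.toList.map fun p => (idxOf ((firstCompat L δ).getD ∅) p, 0, 0))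

/-- The complete code `π₀` of a bad play. [cite: Krajicek1995, Lemma 12.3.10 (proof, step 10)] -/
noncomputable def encode (L : List (Finset (α × β))) (D : Finset α) (R : Finset β)
    (ρ : Finset (α × β)) (pfx : List (Finset (α × β))) (extra : Finset (α × β)) : List (Entry × Bool) :=
  encRounds L D R ρ pfx extra ++ encLast L (playEnd ρ pfx) extra

/-! ### The decoder (Krajíček 1995, Lemma 12.3.10, step 12) -/

/-- Decode the critical set of a round from the move and the indices.
[cite: Krajicek1995, Lemma 12.3.10 (proof, step 12(a))] -/
noncomputable def decKappa (h : Finset (α × β)) (rnd : List Entry) : Finset (α × β) :=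
  (rnd.filterMap fun e => nthOf h e.1).toFinset

/-- Decode one value pair `(x, ν x)`. [cite: Krajicek1995, Lemma 12.3.10 (proof, step 12(a))] -/
noncomputable def decVal (h : Finset (α × β)) (B : Finset β) (e : Entry) : Option (α × β) :=
  (nthOf h e.1).bind fun p => (nthOf B e.2.1).map fun b => (p.1, b)

/-- Decode one preimage pair `(ν⁻¹ y, y)`. [cite: Krajicek1995, Lemma 12.3.10 (proof, step 12(a))] -/
noncomputable def decInv (h : Finset (α × β)) (A : Finset α) (e : Entry) : Option (α × β) :=
  (nthOf h e.1).bind fun p => (nthOf A e.2.2).map fun a => (a, p.2)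

/-- Decode player II's answer of a round. [cite: Krajicek1995, Lemma 12.3.10 (proof, step 12(a))] -/
noncomputable def decNu (D : Finset α) (R : Finset β) (h τ κ : Finset (α × β)) (rnd : List Entry) :
    Finset (α × β) :=
  (rnd.filterMap (decVal h (holesFor R τ κ))).toFinset ∪ (rnd.filterMap (decInv h (pigeonsFor D τ κ))).toFinset

/-- The decoder: from the coding matching `τ` and the code, reconstruct the union of all
critical pairs round by round (`fuel` bounds the number of rounds).
[cite: Krajicek1995, Lemma 12.3.10 (proof, step 12)] -/
noncomputable def decRounds (L : List (Finset (α × β))) (D : Finset α) (R : Finset β) :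
    ℕ → Finset (α × β) → List (Entry × Bool) → Finset (α × β)
  | 0, _, _ => ∅
  | _ + 1, _, [] => ∅
  | f + 1, τ, e :: code =>
    decKappa ((firstCompat L τ).getD ∅) (splitRound (e :: code)).1 ∪
      decRounds L D R f
        ((τ \ decKappa ((firstCompat L τ).getD ∅) (splitRound (e :: code)).1) ∪
          decNu D R ((firstCompat L τ).getD ∅) τ
            (decKappa ((firstCompat L τ).getD ∅) (splitRound (e :: code)).1) (splitRound (e :: code)).1)
        (splitRound (e :: code)).2

/-- The decoder on the empty code. [folklore] -/
theorem decRounds_nil (L : List (Finset (α × β))) (D : Finset α) (R : Finset β) (f : ℕ)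
    (τ : Finset (α × β)) : decRounds L D R f τ [] = ∅ := by
  cases f <;> rfl

/-- One step of the decoder on a marked round. [cite: Krajicek1995, Lemma 12.3.10 (proof, step 12(b))] -/
theorem decRounds_markLast_append (L : List (Finset (α × β))) (D : Finset α) (R : Finset β) (f : ℕ)
    (τ : Finset (α × β)) {l : List Entry} (hl : l ≠ []) (rest : List (Entry × Bool)) :
    decRounds L D R (f + 1) τ (markLast l ++ rest) =
      decKappa ((firstCompat L τ).getD ∅) l ∪
        decRounds L D R f ((τ \ decKappa ((firstCompat L τ).getD ∅) l) ∪
          decNu D R ((firstCompat L τ).getD ∅) τ (decKappa ((firstCompat L τ).getD ∅) l) l) rest := by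
  obtain ⟨e, code, he⟩ := exists_markLast_eq_cons hl rest
  rw [he, decRounds, ← he, splitRound_markLast_append hl]

/-! ### Correctness of the decoder -/

/-- Decoding the indices of a subset `κ ⊆ h` recovers `κ`. [cite: Krajicek1995, Lemma 12.3.10 (proof, step 12(a))] -/
theorem decKappa_map {h κ : Finset (α × β)} (hκ : κ ⊆ h) (g : α × β → ℕ × ℕ) :
    decKappa h (κ.toList.map fun p => (idxOf h p, g p)) = κ := by
  ext q
  rw [decKappa, List.mem_toFinset, List.mem_filterMap]
  constructor
  · rintro ⟨e, he, hq⟩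
    obtain ⟨p, hp, rfl⟩ := List.mem_map.1 he
    rw [Finset.mem_toList] at hp
    rw [nthOf_idxOf (hκ hp), Option.some.injEq] at hq
    exact hq ▸ hp
  · intro hq
    exact ⟨_, List.mem_map.2 ⟨q, Finset.mem_toList.2 hq, rfl⟩, nthOf_idxOf (hκ hq)⟩

/-- **Player II's values are visible to the decoder**: the value of the answer at a critical
pigeon is a hole that is free in `τ` or critical in the round (later critical pairs avoid the
range of the new position). [cite: Krajicek1995, Lemma 12.3.10 (proof, step 9)] -/
theorem val_mem_holesFor {L : List (Finset (α × β))} {D : Finset α} {R : Finset β}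
    {δ ν : Finset (α × β)} {rest : List (Finset (α × β))} {extra : Finset (α × β)}
    (hv : PlayValid L D R δ (ν :: rest)) (hextra : extra ⊆ crit L (playEnd δ (ν :: rest)))
    {a : α} {b : β} (hab : (a, b) ∈ ν) :
    b ∈ holesFor R (tauSet L δ (ν :: rest) extra) (crit L δ) := by
  rw [PlayValid] at hv
  rw [playEnd] at hextra
  rw [holesFor, Finset.mem_union]
  by_cases hbκ : b ∈ rng (crit L δ)
  · exact Or.inr hbκ
  left
  have hνs := (mem_responses.1 hv.2.1).1 hab
  rw [Finset.mem_product, Finset.mem_sdiff, Finset.mem_sdiff] at hνs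
  rw [Finset.mem_sdiff]
  refine ⟨hνs.2.1, fun hbτ => ?_⟩
  rw [tauSet, critUnion, rng_union, rng_union, rng_union, Finset.mem_union, Finset.mem_union,
    Finset.mem_union] at hbτ
  have hbν : b ∈ rng (δ ∪ ν) := by rw [rng_union]; exact Finset.mem_union_right _ (mem_rng.2 ⟨a, hab⟩)
  rcases hbτ with (hb | hb | hb) | hb
  · exact hνs.2.2 hb
  · exact hbκ hb
  · obtain ⟨a', ha'⟩ := mem_rng.1 hb
    exact (critUnion_fresh hv.2.2 _ ha').2 hbν
  · obtain ⟨a', ha'⟩ := mem_rng.1 hb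
    exact (crit_fresh (hextra ha')).2 (rng_mono (subset_playEnd _ _) hbν)

/-- Dually, player II's preimages are visible to the decoder. [cite: Krajicek1995, Lemma 12.3.10 (proof, step 9)] -/
theorem inv_mem_pigeonsFor {L : List (Finset (α × β))} {D : Finset α} {R : Finset β}
    {δ ν : Finset (α × β)} {rest : List (Finset (α × β))} {extra : Finset (α × β)}
    (hv : PlayValid L D R δ (ν :: rest)) (hextra : extra ⊆ crit L (playEnd δ (ν :: rest)))
    {a : α} {b : β} (hab : (a, b) ∈ ν) :
    a ∈ pigeonsFor D (tauSet L δ (ν :: rest) extra) (crit L δ) := by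
  rw [PlayValid] at hv
  rw [playEnd] at hextra
  rw [pigeonsFor, Finset.mem_union]
  by_cases haκ : a ∈ dom (crit L δ)
  · exact Or.inr haκ
  left
  have hνs := (mem_responses.1 hv.2.1).1 hab
  rw [Finset.mem_product, Finset.mem_sdiff, Finset.mem_sdiff] at hνs
  rw [Finset.mem_sdiff]
  refine ⟨hνs.1.1, fun haτ => ?_⟩
  rw [tauSet, critUnion, dom_union, dom_union, dom_union, Finset.mem_union, Finset.mem_union,
    Finset.mem_union] at haτ
  have haν : a ∈ dom (δ ∪ ν) := by rw [dom_union]; exact Finset.mem_union_right _ (mem_dom.2 ⟨b, hab⟩)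
  rcases haτ with (ha | ha | ha) | ha
  · exact hνs.1.2 ha
  · exact haκ ha
  · obtain ⟨b', hb'⟩ := mem_dom.1 ha
    exact (critUnion_fresh hv.2.2 _ hb').1 haν
  · obtain ⟨b', hb'⟩ := mem_dom.1 ha
    exact (crit_fresh (hextra hb')).1 (dom_mono (subset_playEnd _ _) haν)

/-- **Decoding a round's answer**: from the move, the code of the round and `τ`, the decoder
recovers player II's answer. [cite: Krajicek1995, Lemma 12.3.10 (proof, step 12(a))] -/
theorem decNu_encRound {L : List (Finset (α × β))} {D : Finset α} {R : Finset β}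
    {δ ν h : Finset (α × β)} {rest : List (Finset (α × β))} {extra : Finset (α × β)}
    (hv : PlayValid L D R δ (ν :: rest)) (hextra : extra ⊆ crit L (playEnd δ (ν :: rest)))
    (hf : firstCompat L δ = some h) :
    decNu D R h (tauSet L δ (ν :: rest) extra) (crit L δ)
      (encRound D R h (crit L δ) ν (tauSet L δ (ν :: rest) extra)) = ν := by
  have hv' := hv
  rw [PlayValid] at hv'
  obtain ⟨-, hνm, hdom, hrng, -⟩ := mem_responses.1 hv'.2.1
  have hκh : crit L δ ⊆ h := by rw [crit_eq_of_some hf]; exact Finset.sdiff_subset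
  set τ := tauSet L δ (ν :: rest) extra with hτ
  set κ := crit L δ with hκ
  -- the values and preimages of the critical pairs
  have hval : ∀ p ∈ κ, ∃ b, valOf ν p.1 = some b ∧ (p.1, b) ∈ ν := by
    intro p hp
    obtain ⟨b, hb⟩ := mem_dom.1 (hdom (mem_dom.2 ⟨p.2, hp⟩))
    exact ⟨b, (valOf_eq_some_iff hνm).2 hb, hb⟩
  have hinv : ∀ p ∈ κ, ∃ a, invOf ν p.2 = some a ∧ (a, p.2) ∈ ν := by
    intro p hp
    obtain ⟨a, ha⟩ := mem_rng.1 (hrng (mem_rng.2 ⟨p.1, hp⟩))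
    exact ⟨a, (invOf_eq_some_iff hνm).2 ha, ha⟩
  -- what the two decoders produce on the entry of `p ∈ κ`
  have hdecV : ∀ p ∈ κ, ∀ b, (p.1, b) ∈ ν →
      decVal h (holesFor R τ κ) (idxOf h p, oidxOf (holesFor R τ κ) (valOf ν p.1),
        oidxOf (pigeonsFor D τ κ) (invOf ν p.2)) = some (p.1, b) := by
    intro p hp b hb
    obtain ⟨b', hb', hb'ν⟩ := hval p hp
    have : b' = b := hνm.eq_of_fst_eq hb'ν hb
    subst this
    have hmem : b' ∈ holesFor R τ κ := val_mem_holesFor hv hextra hb'ν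
    simp only [decVal, nthOf_idxOf (hκh hp), Option.bind_some, hb', oidxOf]
    rw [nthOf_idxOf hmem]; rfl
  have hdecI : ∀ p ∈ κ, ∀ a, (a, p.2) ∈ ν →
      decInv h (pigeonsFor D τ κ) (idxOf h p, oidxOf (holesFor R τ κ) (valOf ν p.1),
        oidxOf (pigeonsFor D τ κ) (invOf ν p.2)) = some (a, p.2) := by
    intro p hp a ha
    obtain ⟨a', ha', ha'ν⟩ := hinv p hp
    have : a' = a := hνm.eq_of_snd_eq ha'ν ha
    subst this
    have hmem : a' ∈ pigeonsFor D τ κ := inv_mem_pigeonsFor hv hextra ha'ν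
    simp only [decInv, nthOf_idxOf (hκh hp), Option.bind_some, ha', oidxOf]
    rw [nthOf_idxOf hmem]; rfl
  -- compare with the decomposition of `ν`
  conv_rhs => rw [response_eq_union_filter hv'.2.1]
  unfold decNu encRound
  congr 1
  · ext q
    rw [List.mem_toFinset, List.mem_filterMap, Finset.mem_filter]
    constructor
    · rintro ⟨e, he, hq⟩
      obtain ⟨p, hp, rfl⟩ := List.mem_map.1 he
      rw [Finset.mem_toList] at hp
      obtain ⟨b, -, hb⟩ := hval p hp
      rw [hdecV p hp b hb, Option.some.injEq] at hq
      subst hq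
      exact ⟨hb, mem_dom.2 ⟨p.2, hp⟩⟩
    · rintro ⟨hqν, hqκ⟩
      obtain ⟨b, hb⟩ := mem_dom.1 hqκ
      refine ⟨_, List.mem_map.2 ⟨(q.1, b), Finset.mem_toList.2 hb, rfl⟩, ?_⟩
      rw [hdecV (q.1, b) hb q.2 hqν]
  · ext q
    rw [List.mem_toFinset, List.mem_filterMap, Finset.mem_filter]
    constructor
    · rintro ⟨e, he, hq⟩
      obtain ⟨p, hp, rfl⟩ := List.mem_map.1 he
      rw [Finset.mem_toList] at hp
      obtain ⟨a, -, ha⟩ := hinv p hp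
      rw [hdecI p hp a ha, Option.some.injEq] at hq
      subst hq
      exact ⟨ha, mem_rng.2 ⟨p.1, hp⟩⟩
    · rintro ⟨hqν, hqκ⟩
      obtain ⟨a, ha⟩ := mem_rng.1 hqκ
      refine ⟨_, List.mem_map.2 ⟨(a, q.2), Finset.mem_toList.2 ha, rfl⟩, ?_⟩
      rw [hdecI (a, q.2) ha q.1 hqν]

/-- **The code determines the critical pairs** (Krajíček 1995, Lemma 12.3.10, step 12(c)):
started on the coding matching `τ` of a play with the code of the play, the decoder returns
the union of all (answered and final) critical pairs. [cite: Krajicek1995, Lemma 12.3.10 (proof, step 12(c))] -/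
theorem decRounds_encode {L : List (Finset (α × β))} {D : Finset α} {R : Finset β}
    (hL : ∀ h ∈ L, IsPMatching h) :
    ∀ (pfx : List (Finset (α × β))) {δ extra : Finset (α × β)} {fuel : ℕ},
      PlayValid L D R δ pfx → IsPMatching δ → extra ⊆ crit L (playEnd δ pfx) → extra ≠ ∅ →
      pfx.length < fuel →
      decRounds L D R fuel (tauSet L δ pfx extra)
        (encRounds L D R δ pfx extra ++ encLast L (playEnd δ pfx) extra) = critUnion L δ pfx ∪ extra
  | [], δ, extra, fuel, hv, hδ, hextra, hne, hfuel => by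
    obtain ⟨f, rfl⟩ : ∃ f, fuel = f + 1 := ⟨fuel - 1, by omega⟩
    rw [playEnd] at hextra
    have hcrit : crit L δ ≠ ∅ := fun h0 => hne (Finset.subset_empty.1 (h0 ▸ hextra))
    obtain ⟨h, hf, hκ, -⟩ := exists_of_crit_ne_empty hcrit
    have hfirst : firstCompat L (tauSet L δ [] extra) = some h := firstCompat_tauSet hL hv hδ hextra hf
    have hl : (extra.toList.map fun p => (idxOf ((firstCompat L δ).getD ∅) p, (0 : ℕ), (0 : ℕ))) ≠ [] := by
      rw [Ne, List.map_eq_nil_iff, Finset.toList_eq_nil]; exact hne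
    rw [encRounds, List.nil_append, playEnd, encLast, ← List.append_nil (markLast _),
      decRounds_markLast_append L D R f _ hl, decRounds_nil, Finset.union_empty, critUnion,
      Finset.empty_union, hfirst, Option.getD_some, hf, Option.getD_some]
    exact decKappa_map (hextra.trans (hκ ▸ Finset.sdiff_subset)) _
  | ν :: rest, δ, extra, fuel, hv, hδ, hextra, hne, hfuel => by
    obtain ⟨f, rfl⟩ : ∃ f, fuel = f + 1 := ⟨fuel - 1, by omega⟩
    have hv' := hv
    rw [PlayValid] at hv'
    obtain ⟨h, hf, hκ, -⟩ := exists_of_crit_ne_empty hv'.1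
    have hfirst : firstCompat L (tauSet L δ (ν :: rest) extra) = some h :=
      firstCompat_tauSet hL hv hδ hextra hf
    have hκh : crit L δ ⊆ h := hκ ▸ Finset.sdiff_subset
    have hl : encRound D R h (crit L δ) ν (tauSet L δ (ν :: rest) extra) ≠ [] := by
      rw [encRound, Ne, List.map_eq_nil_iff, Finset.toList_eq_nil]; exact hv'.1
    have ih := decRounds_encode hL rest (δ := δ ∪ ν) (extra := extra) (fuel := f) hv'.2.2
      (isPMatching_union_response hδ hv'.2.1) hextra hne (by simpa using hfuel)
    rw [encRounds, hf, Option.getD_some, List.append_assoc, decRounds_markLast_append L D R f _ hl,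
      hfirst, Option.getD_some, encRound, decKappa_map hκh, ← encRound, decNu_encRound hv hextra hf,
      tauSet_next hv hextra, playEnd, ih, critUnion, Finset.union_assoc]

end Literature.Computability.MetaComplexity.PBij


namespace Literature.Computability.MetaComplexity.PBij

variable {α β : Type*} [DecidableEq α] [DecidableEq β]

/-! ### Bad restrictions and their witnesses -/

/-- Each round of a valid play answers at least one critical pair. [folklore] -/
theorem length_le_playCrit {L : List (Finset (α × β))} {D : Finset α} {R : Finset β} :
    ∀ {δ : Finset (α × β)} {pfx : List (Finset (α × β))}, PlayValid L D R δ pfx →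
      pfx.length ≤ playCrit L δ pfx
  | _, [], _ => le_rfl
  | δ, ν :: rest, hv => by
    rw [PlayValid] at hv
    have h1 : 1 ≤ (crit L δ).card := Finset.card_pos.2 (Finset.nonempty_iff_ne_empty.2 hv.1)
    have ih := length_le_playCrit hv.2.2
    rw [List.length_cons, playCrit]; omega

/-- A play meeting more than `s'` critical pairs has a prefix that answers at most `s'` critical
pairs and meets the `(s'+1)`-st one in its pending critical set (truncation of a bad play,
Krajíček 1995, Lemma 12.3.10, proof, step 6). [cite: Krajicek1995, Lemma 12.3.10 (proof, step 6)] -/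
theorem exists_bad_prefix {L : List (Finset (α × β))} {D : Finset α} {R : Finset β} :
    ∀ (play : List (Finset (α × β))) {ρ : Finset (α × β)} (s' : ℕ), PlayValid L D R ρ play →
      s' < playCrit L ρ play + (crit L (playEnd ρ play)).card →
      ∃ pfx, PlayValid L D R ρ pfx ∧ playCrit L ρ pfx ≤ s' ∧
        s' < playCrit L ρ pfx + (crit L (playEnd ρ pfx)).card
  | [], _, s', _, hs => ⟨[], trivial, Nat.zero_le _, hs⟩
  | ν :: rest, ρ, s', hv, hs => by
    by_cases hlt : s' < (crit L ρ).card
    · exact ⟨[], trivial, Nat.zero_le _, by simpa [playCrit, playEnd] using hlt⟩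
    · rw [PlayValid] at hv
      rw [playCrit, playEnd, Nat.add_assoc] at hs
      obtain ⟨pfx, hpfx, h1, h2⟩ := exists_bad_prefix rest (s' - (crit L ρ).card) hv.2.2 (by omega)
      refine ⟨ν :: pfx, ⟨hv.1, hv.2.1, hpfx⟩, ?_, ?_⟩
      · rw [playCrit]; omega
      · rw [playCrit, playEnd]; omega

/-- **Witness of badness**: if `ρ` is not good for `s`, some valid play from `ρ` and a nonempty
part `extra` of its pending critical set record exactly `s + 1` critical pairs.
[cite: Krajicek1995, Lemma 12.3.10 (proof, step 6)] -/
theorem exists_witness {L : List (Finset (α × β))} {D : Finset α} {R : Finset β}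
    {ρ : Finset (α × β)} {s : ℕ} (hbad : ¬ Good L D R ρ s) :
    ∃ pfx extra, PlayValid L D R ρ pfx ∧ extra ⊆ crit L (playEnd ρ pfx) ∧ extra ≠ ∅ ∧
      playCrit L ρ pfx + extra.card = s + 1 := by
  unfold Good at hbad
  push Not at hbad
  obtain ⟨play, hplay, hs⟩ := hbad
  obtain ⟨pfx, hpfx, h1, h2⟩ := exists_bad_prefix play s hplay hs
  obtain ⟨extra, hsub, hcard⟩ := Finset.exists_subset_card_eq
    (s := crit L (playEnd ρ pfx)) (n := s + 1 - playCrit L ρ pfx) (by omega)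
  refine ⟨pfx, extra, hpfx, hsub, ?_, by omega⟩
  exact Finset.nonempty_iff_ne_empty.1 (Finset.card_pos.1 (by omega))

end Literature.Computability.MetaComplexity.PBij


namespace Literature.Computability.MetaComplexity.PBij

variable {α β : Type*} [DecidableEq α] [DecidableEq β]

/-! ### Size and position of the coding matching `τ` -/

/-- The pigeons of all critical pairs met are in the final position. [folklore] -/
theorem fst_mem_dom_playEnd_of_mem_critUnion {L : List (Finset (α × β))} {D : Finset α} {R : Finset β} :
    ∀ {δ : Finset (α × β)} {pfx : List (Finset (α × β))}, PlayValid L D R δ pfx →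
      ∀ p ∈ critUnion L δ pfx, p.1 ∈ dom (playEnd δ pfx)
  | _, [], _, p, hp => absurd hp (Finset.notMem_empty p)
  | δ, ν :: rest, hv, p, hp => by
    rw [PlayValid] at hv
    rw [critUnion, Finset.mem_union] at hp
    rw [playEnd]
    rcases hp with hp | hp
    · have : p.1 ∈ dom (δ ∪ ν) := by
        rw [dom_union]
        exact Finset.mem_union_right _ ((mem_responses.1 hv.2.1).2.2.1 (mem_dom.2 ⟨p.2, hp⟩))
      exact dom_mono (subset_playEnd _ _) this
    · exact fst_mem_dom_playEnd_of_mem_critUnion hv.2.2 p hp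

/-- `|τ| = |ρ| + (critical pairs answered) + |extra|`, i.e. `|τ| = w + s + 1` for a witness
(Krajíček: `|τ| = w + s`). [cite: Krajicek1995, Lemma 12.3.10 (proof, step 8)] -/
theorem card_tauSet {L : List (Finset (α × β))} {D : Finset α} {R : Finset β}
    {δ : Finset (α × β)} {pfx : List (Finset (α × β))} {extra : Finset (α × β)}
    (hv : PlayValid L D R δ pfx) (hextra : extra ⊆ crit L (playEnd δ pfx)) :
    (tauSet L δ pfx extra).card = δ.card + playCrit L δ pfx + extra.card := by
  have hd1 : Disjoint δ (critUnion L δ pfx) := by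
    rw [Finset.disjoint_right]
    intro p hp hpδ
    exact (critUnion_fresh hv p hp).1 (mem_dom.2 ⟨p.2, hpδ⟩)
  have hd2 : Disjoint (δ ∪ critUnion L δ pfx) extra := by
    rw [Finset.disjoint_right]
    intro p hp hpu
    have hfresh := crit_fresh (hextra hp)
    rw [Finset.mem_union] at hpu
    rcases hpu with hpu | hpu
    · exact hfresh.1 (dom_mono (subset_playEnd _ _) (mem_dom.2 ⟨p.2, hpu⟩))
    · exact hfresh.1 (fst_mem_dom_playEnd_of_mem_critUnion hv p hpu)
  rw [tauSet, Finset.card_union_of_disjoint hd2, Finset.card_union_of_disjoint hd1, card_critUnion hv]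

/-- `τ` lies in the universe. [folklore] -/
theorem tauSet_subset_universe {L : List (Finset (α × β))} {D : Finset α} {R : Finset β}
    (hL : ∀ h ∈ L, h ⊆ D ×ˢ R) {δ : Finset (α × β)} (hδ : δ ⊆ D ×ˢ R) (pfx : List (Finset (α × β)))
    {extra : Finset (α × β)} (hextra : extra ⊆ crit L (playEnd δ pfx)) :
    tauSet L δ pfx extra ⊆ D ×ˢ R :=
  Finset.union_subset (Finset.union_subset hδ (critUnion_subset_universe hL δ pfx))
    (hextra.trans (crit_subset_universe hL _))

/-- Along the decoding the coding matchings do not shrink. [cite: Krajicek1995, Lemma 12.3.10 (proof, step 12(b))] -/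
theorem card_tauSet_le_next {L : List (Finset (α × β))} {D : Finset α} {R : Finset β}
    (hL : ∀ h ∈ L, IsPMatching h) {δ ν : Finset (α × β)} {rest : List (Finset (α × β))}
    {extra : Finset (α × β)} (hv : PlayValid L D R δ (ν :: rest))
    (hextra : extra ⊆ crit L (playEnd δ (ν :: rest))) :
    (tauSet L δ (ν :: rest) extra).card ≤ (tauSet L (δ ∪ ν) rest extra).card := by
  rw [← tauSet_next hv hextra]
  have hv' := hv
  rw [PlayValid] at hv'
  rw [playEnd] at hextra
  obtain ⟨-, hνm, hdom, -, -⟩ := mem_responses.1 hv'.2.1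
  -- `ν` is disjoint from `τ ∖ κ`
  have hdisj : Disjoint (tauSet L δ (ν :: rest) extra \ crit L δ) ν := by
    rw [Finset.disjoint_right]
    intro p hpν hp
    rw [Finset.mem_sdiff, tauSet, critUnion, Finset.mem_union, Finset.mem_union, Finset.mem_union] at hp
    obtain ⟨((hp | hp | hp) | hp), hpκ⟩ := hp
    · exact Finset.disjoint_left.1 (disjoint_response hv'.2.1) hp hpν
    · exact hpκ hp
    · exact (critUnion_fresh hv'.2.2 p hp).1 (by rw [dom_union]; exact Finset.mem_union_right _ (mem_dom.2 ⟨p.2, hpν⟩))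
    · exact (crit_fresh (hextra hp)).1 (dom_mono (subset_playEnd _ _)
        (by rw [dom_union]; exact Finset.mem_union_right _ (mem_dom.2 ⟨p.2, hpν⟩)))
  have hκsub : crit L δ ⊆ tauSet L δ (ν :: rest) extra := by
    intro p hp; rw [tauSet, critUnion]; simp [hp]
  have hκν : (crit L δ).card ≤ ν.card :=
    calc (crit L δ).card = (dom (crit L δ)).card := ((isPMatching_crit hL δ).card_dom).symm
      _ ≤ (dom ν).card := Finset.card_le_card hdom
      _ ≤ ν.card := card_dom_le ν
  rw [Finset.card_union_of_disjoint hdisj, Finset.card_sdiff_of_subset hκsub]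
  have := Finset.card_le_card hκsub
  omega

/-! ### Length and bounds of the code -/

/-- The code of the full rounds has one entry per critical pair answered. [folklore] -/
theorem length_encRounds (L : List (Finset (α × β))) (D : Finset α) (R : Finset β) :
    ∀ (δ : Finset (α × β)) (pfx : List (Finset (α × β))) (extra : Finset (α × β)),
      (encRounds L D R δ pfx extra).length = playCrit L δ pfx
  | _, [], _ => rfl
  | δ, ν :: rest, extra => by
    rw [encRounds, List.length_append, length_markLast, encRound, List.length_map,
      Finset.length_toList, length_encRounds L D R (δ ∪ ν) rest extra, playCrit]

/-- The whole code has `playCrit + |extra|` entries (`= s + 1` for a witness). [folklore] -/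
theorem length_encode (L : List (Finset (α × β))) (D : Finset α) (R : Finset β)
    (ρ : Finset (α × β)) (pfx : List (Finset (α × β))) (extra : Finset (α × β)) :
    (encode L D R ρ pfx extra).length = playCrit L ρ pfx + extra.card := by
  rw [encode, List.length_append, length_encRounds, encLast, length_markLast, List.length_map,
    Finset.length_toList]

/-- **Bounds on the code entries** (Krajíček 1995, Lemma 12.3.10, step 11): indices of critical
pairs are `≤ t`, indices of values and preimages are `≤ |R| + t - w` (the coding matchings have
at least `w + 1` elements). [cite: Krajicek1995, Lemma 12.3.10 (proof, step 11)] -/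
theorem encRounds_bounds {L : List (Finset (α × β))} {D : Finset α} {R : Finset β} {t w : ℕ}
    (hL : ∀ h ∈ L, IsPMatching h ∧ h ⊆ D ×ˢ R ∧ h.card ≤ t) (hDR : D.card = R.card + 1) :
    ∀ (pfx : List (Finset (α × β))) {δ extra : Finset (α × β)}, PlayValid L D R δ pfx →
      IsPMatching δ → δ ⊆ D ×ˢ R → extra ⊆ crit L (playEnd δ pfx) →
      w + 1 ≤ (tauSet L δ pfx extra).card →
      ∀ x ∈ encRounds L D R δ pfx extra, x.1.1 ≤ t ∧ x.1.2.1 ≤ R.card + t - w ∧ x.1.2.2 ≤ R.card + t - w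
  | [], _, _, _, _, _, _, _, x, hx => absurd hx List.not_mem_nil
  | ν :: rest, δ, extra, hv, hδ, hδs, hextra, hcard, x, hx => by
    have hLm : ∀ h ∈ L, IsPMatching h := fun h hh => (hL h hh).1
    have hLs : ∀ h ∈ L, h ⊆ D ×ˢ R := fun h hh => (hL h hh).2.1
    have hLt : ∀ h ∈ L, h.card ≤ t := fun h hh => (hL h hh).2.2
    have hv' := hv
    rw [PlayValid] at hv'
    rw [encRounds, List.mem_append] at hx
    rcases hx with hx | hx
    · -- an entry of the first round
      have hx' := fst_mem_of_mem_markLast hx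
      rw [encRound, List.mem_map] at hx'
      obtain ⟨p, hp, hpx⟩ := hx'
      rw [Finset.mem_toList] at hp
      obtain ⟨h, hf, hκ, -⟩ := exists_of_crit_ne_empty hv'.1
      rw [hf, Option.getD_some] at hpx
      set τ := tauSet L δ (ν :: rest) extra with hτdef
      have hτm : IsPMatching τ := isPMatching_tauSet hLm hv hδ hextra
      have hτs : τ ⊆ D ×ˢ R := tauSet_subset_universe hLs hδs _ hextra
      have hκt : (crit L δ).card ≤ t := card_crit_le hLt δ
      have hB : (holesFor R τ (crit L δ)).card + w + 1 ≤ R.card + t := by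
        have h1 : (holesFor R τ (crit L δ)).card ≤ (R \ rng τ).card + (rng (crit L δ)).card :=
          Finset.card_union_le _ _
        have h2 := Finset.card_sdiff_add_card_eq_card (rng_subset_of_subset_product hτs)
        have h3 := hτm.card_rng
        have h4 := card_rng_le (crit L δ)
        omega
      have hA : (pigeonsFor D τ (crit L δ)).card + w + 1 ≤ D.card + t := by
        have h1 : (pigeonsFor D τ (crit L δ)).card ≤ (D \ dom τ).card + (dom (crit L δ)).card :=
          Finset.card_union_le _ _
        have h2 := Finset.card_sdiff_add_card_eq_card (dom_subset_of_subset_product hτs)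
        have h3 := hτm.card_dom
        have h4 := card_dom_le (crit L δ)
        omega
      rw [← hpx]
      refine ⟨?_, ?_, ?_⟩
      · show idxOf h p ≤ t
        have := idxOf_lt_card ((hκ ▸ Finset.sdiff_subset : crit L δ ⊆ h) hp)
        have := hLt h (firstCompat_spec hf).1
        omega
      · show oidxOf (holesFor R τ (crit L δ)) (valOf ν p.1) ≤ R.card + t - w
        have := oidxOf_lt_succ_card (holesFor R τ (crit L δ)) (valOf ν p.1)
        omega
      · show oidxOf (pigeonsFor D τ (crit L δ)) (invOf ν p.2) ≤ R.card + t - w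
        have := oidxOf_lt_succ_card (pigeonsFor D τ (crit L δ)) (invOf ν p.2)
        omega
    · -- an entry of a later round
      rw [playEnd] at hextra
      exact encRounds_bounds hL hDR rest hv'.2.2 (isPMatching_union_response hδ hv'.2.1)
        (Finset.union_subset hδs (response_subset_universe hv'.2.1)) hextra
        (hcard.trans (card_tauSet_le_next hLm hv (by rw [playEnd]; exact hextra))) x hx

/-- Bounds on the entries of the final round. [cite: Krajicek1995, Lemma 12.3.10 (proof, step 11)] -/
theorem encLast_bounds {L : List (Finset (α × β))} {t : ℕ} (hL : ∀ h ∈ L, h.card ≤ t)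
    {δ extra : Finset (α × β)} (hextra : extra ⊆ crit L δ) :
    ∀ x ∈ encLast L δ extra, x.1.1 ≤ t ∧ x.1.2.1 = 0 ∧ x.1.2.2 = 0 := by
  intro x hx
  have hx' := fst_mem_of_mem_markLast hx
  rw [List.mem_map] at hx'
  obtain ⟨p, hp, hpx⟩ := hx'
  rw [Finset.mem_toList] at hp
  rw [← hpx]
  refine ⟨?_, rfl, rfl⟩
  by_cases hne : crit L δ = ∅
  · rw [hne] at hextra; exact absurd (hextra hp) (Finset.notMem_empty p)
  · obtain ⟨h, hf, hκ, -⟩ := exists_of_crit_ne_empty hne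
    rw [hf, Option.getD_some]
    have := idxOf_lt_card ((hκ ▸ Finset.sdiff_subset : crit L δ ⊆ h) (hextra hp))
    have := hL h (firstCompat_spec hf).1
    show idxOf h p ≤ t
    omega

/-! ### Codes as elements of a finite type -/

/-- Truncation into `Fin (K + 1)` (the identity below `K`). [folklore] -/
def finClamp (K n : ℕ) : Fin (K + 1) :=
  ⟨min n K, Nat.lt_succ_of_le (Nat.min_le_right n K)⟩

omit [DecidableEq α] [DecidableEq β] in
/-- `finClamp` is injective on `{0, …, K}`. [folklore] -/
theorem finClamp_eq_finClamp {K n m : ℕ} (hn : n ≤ K) (hm : m ≤ K) (h : finClamp K n = finClamp K m) :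
    n = m := by
  have := congrArg Fin.val h
  simp only [finClamp] at this
  rw [Nat.min_eq_left hn, Nat.min_eq_left hm] at this
  exact this

/-- The finite type of codes: for each of the `s + 1` recorded critical pairs a triple of
bounded indices and a mark. [cite: Krajicek1995, Lemma 12.3.10 (proof, step 11)] -/
abbrev Code (t M s : ℕ) : Type :=
  Fin (s + 1) → (Fin (t + 1) × Fin (M + 1) × Fin (M + 1)) × Bool

/-- Reading a code (a list) as an element of the finite type of codes. [folklore] -/
def toCode (t M s : ℕ) (c : List (Entry × Bool)) : Code t M s :=
  fun i =>
    let x := c.getD i ((0, 0, 0), false)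
    ((finClamp t x.1.1, finClamp M x.1.2.1, finClamp M x.1.2.2), x.2)

omit [DecidableEq α] [DecidableEq β] in
/-- `toCode` is injective on bounded lists of length `s + 1`. [folklore] -/
theorem toCode_injective {t M s : ℕ} {c₁ c₂ : List (Entry × Bool)} (h₁ : c₁.length = s + 1)
    (h₂ : c₂.length = s + 1)
    (hb₁ : ∀ x ∈ c₁, x.1.1 ≤ t ∧ x.1.2.1 ≤ M ∧ x.1.2.2 ≤ M)
    (hb₂ : ∀ x ∈ c₂, x.1.1 ≤ t ∧ x.1.2.1 ≤ M ∧ x.1.2.2 ≤ M)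
    (h : toCode t M s c₁ = toCode t M s c₂) : c₁ = c₂ := by
  apply List.ext_getElem (h₁.trans h₂.symm)
  intro i hi₁ hi₂
  have hi : i < s + 1 := h₁ ▸ hi₁
  have := congrFun h ⟨i, hi⟩
  simp only [toCode] at this
  simp only [List.getD_eq_getElem?_getD, List.getElem?_eq_getElem hi₁, List.getElem?_eq_getElem hi₂,
    Option.getD_some] at this
  simp only [Prod.mk.injEq] at this
  obtain ⟨⟨k1, k2, k3⟩, k4⟩ := this
  have B1 := hb₁ _ (List.getElem_mem hi₁)
  have B2 := hb₂ _ (List.getElem_mem hi₂)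
  exact Prod.ext (Prod.ext (finClamp_eq_finClamp B1.1 B2.1 k1)
    (Prod.ext (finClamp_eq_finClamp B1.2.1 B2.2.1 k2) (finClamp_eq_finClamp B1.2.2 B2.2.2 k3))) k4

end Literature.Computability.MetaComplexity.PBij


namespace Literature.Computability.MetaComplexity.PBij

variable {α β : Type*} [DecidableEq α] [DecidableEq β]

/-! ### Recovering `ρ` from `τ` and the code -/

/-- **`τ` and the code determine `ρ`** (Krajíček 1995, Lemma 12.3.10, step 12(c):
`ρ = τ ∖ ⋃ᵢ κᵢ`). [cite: Krajicek1995, Lemma 12.3.10 (proof, step 12(c))] -/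
theorem tauSet_sdiff_decRounds {L : List (Finset (α × β))} {D : Finset α} {R : Finset β}
    (hL : ∀ h ∈ L, IsPMatching h) {ρ : Finset (α × β)} {pfx : List (Finset (α × β))}
    {extra : Finset (α × β)} {fuel : ℕ} (hv : PlayValid L D R ρ pfx) (hρ : IsPMatching ρ)
    (hextra : extra ⊆ crit L (playEnd ρ pfx)) (hne : extra ≠ ∅) (hfuel : pfx.length < fuel) :
    tauSet L ρ pfx extra \ decRounds L D R fuel (tauSet L ρ pfx extra) (encode L D R ρ pfx extra) = ρ := by
  rw [encode, decRounds_encode hL pfx hv hρ hextra hne hfuel, tauSet, Finset.union_assoc]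
  refine Finset.union_sdiff_cancel_right ?_
  rw [Finset.disjoint_right]
  intro p hp hpρ
  rw [Finset.mem_union] at hp
  rcases hp with hp | hp
  · exact (critUnion_fresh hv p hp).1 (mem_dom.2 ⟨p.2, hpρ⟩)
  · exact (crit_fresh (hextra hp)).1 (dom_mono (subset_playEnd _ _) (mem_dom.2 ⟨p.2, hpρ⟩))

/-! ### Counting matchings (Krajíček 1995, Lemma 12.3.10, step 13) -/

/-- The matchings of size `r` of the universe `D × R` (Krajíček's `{ρ ∈ 𝓜 | |ρ| = w}`).
[cite: Krajicek1995, Lemma 12.3.10 (proof, step 13)] -/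
def matchingsOfCard (D : Finset α) (R : Finset β) (r : ℕ) : Finset (Finset (α × β)) :=
  ((D ×ˢ R).powersetCard r).filter IsPMatching

/-- Membership in `matchingsOfCard`. [cite: Krajicek1995, Lemma 12.3.10 (proof, step 13)] -/
theorem mem_matchingsOfCard {D : Finset α} {R : Finset β} {r : ℕ} {σ : Finset (α × β)} :
    σ ∈ matchingsOfCard D R r ↔ σ ⊆ D ×ˢ R ∧ σ.card = r ∧ IsPMatching σ := by
  rw [matchingsOfCard, Finset.mem_filter, Finset.mem_powersetCard, and_assoc]

/-- There are matchings of every size `w ≤ |R| ≤ |D|`. [folklore] -/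
theorem matchingsOfCard_nonempty {D : Finset α} {R : Finset β} {w : ℕ} (hDR : R.card ≤ D.card)
    (hw : w ≤ R.card) : (matchingsOfCard D R w).Nonempty := by
  obtain ⟨P, hP, hPc⟩ := Finset.exists_subset_card_eq (s := D) (n := w) (by omega)
  obtain ⟨ν, hν, hdom, hrng⟩ := exists_matching_left P R (by rw [hPc]; exact hw)
  refine ⟨ν, mem_matchingsOfCard.2 ⟨fun p hp => ?_, ?_, hν⟩⟩
  · rw [Finset.mem_product]
    exact ⟨hP (hdom ▸ mem_dom.2 ⟨p.2, hp⟩), hrng (mem_rng.2 ⟨p.1, hp⟩)⟩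
  · rw [← hν.card_dom, hdom, hPc]

/-- **Double counting of the pairs `ρ ⊆ τ`** (Krajíček 1995, Lemma 12.3.10, step 13: there are
`C(w+e, w)` matchings `ρ` of size `w` inside a matching `τ` of size `w + e`, and every `ρ` of
size `w` has at most `((|D|-w)(|R|-w))^e` extensions — we use this crude upper bound instead of
the exact `C(|D|-w, e) C(|R|-w, e) e!`). [cite: Krajicek1995, Lemma 12.3.10 (proof, step 13)] -/
theorem card_matchings_mul_choose_le (D : Finset α) (R : Finset β) (w e : ℕ) :
    (matchingsOfCard D R (w + e)).card * Nat.choose (w + e) w ≤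
      (matchingsOfCard D R w).card * ((D.card - w) * (R.card - w)) ^ e := by
  refine Finset.card_mul_le_card_mul (fun τ ρ => ρ ⊆ τ) (fun τ hτ => ?_) (fun ρ hρ => ?_)
  · -- every `w`-subset of `τ` is a matching of size `w` inside `τ`
    obtain ⟨hτs, hτc, hτm⟩ := mem_matchingsOfCard.1 hτ
    calc Nat.choose (w + e) w = (τ.powersetCard w).card := by rw [Finset.card_powersetCard, hτc]
      _ ≤ _ := Finset.card_le_card fun ρ hρ => by
          rw [Finset.mem_powersetCard] at hρ
          rw [Finset.mem_bipartiteAbove, mem_matchingsOfCard]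
          exact ⟨⟨hρ.1.trans hτs, hρ.2, hτm.subset hρ.1⟩, hρ.1⟩
  · -- the extensions of `ρ` inject into the `e`-subsets of the restricted universe
    obtain ⟨hρs, hρc, hρm⟩ := mem_matchingsOfCard.1 hρ
    have hU : ((D \ dom ρ) ×ˢ (R \ rng ρ)).card = (D.card - w) * (R.card - w) := by
      have h1 := card_restrictedDomain hρm hρs
      have h2 := card_restrictedRange hρm hρs
      rw [Finset.card_product]
      congr 1 <;> omega
    calc (Finset.bipartiteBelow (fun τ ρ => ρ ⊆ τ) (matchingsOfCard D R (w + e)) ρ).card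
        ≤ (((D \ dom ρ) ×ˢ (R \ rng ρ)).powersetCard e).card := by
          refine Finset.card_le_card_of_injOn (fun τ => τ \ ρ) (fun τ hτ => ?_) (fun τ₁ hτ₁ τ₂ hτ₂ h => ?_)
          · have hτ' : τ ∈ matchingsOfCard D R (w + e) ∧ ρ ⊆ τ := by
              simpa [Finset.bipartiteBelow] using hτ
            obtain ⟨hτ, hρτ⟩ := hτ'
            obtain ⟨hτs, hτc, hτm⟩ := mem_matchingsOfCard.1 hτ
            refine Finset.mem_coe.2 (Finset.mem_powersetCard.2 ⟨?_, ?_⟩)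
            · exact sdiff_subset_restrictedUniverse hτs (hτm.compat_of_subset hρτ)
            · rw [Finset.card_sdiff_of_subset hρτ, hτc, hρc]; omega
          · have h₁ : ρ ⊆ τ₁ := by
              have : τ₁ ∈ matchingsOfCard D R (w + e) ∧ ρ ⊆ τ₁ := by
                simpa [Finset.bipartiteBelow] using hτ₁
              exact this.2
            have h₂ : ρ ⊆ τ₂ := by
              have : τ₂ ∈ matchingsOfCard D R (w + e) ∧ ρ ⊆ τ₂ := by
                simpa [Finset.bipartiteBelow] using hτ₂
              exact this.2
            have e₁ := Finset.union_sdiff_of_subset h₁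
            have e₂ := Finset.union_sdiff_of_subset h₂
            rw [← e₁, ← e₂]
            exact congrArg (ρ ∪ ·) h
      _ = Nat.choose ((D.card - w) * (R.card - w)) e := by rw [Finset.card_powersetCard, hU]
      _ ≤ ((D.card - w) * (R.card - w)) ^ e := Nat.choose_le_pow _ _

/-! ### The PHP switching lemma -/

/-- **Existence of a good restriction** (the counting core of Krajíček 1995, Lemma 12.3.10,
steps 4–13; KPW 1995): if `N` sets of matchings of norm `≤ t` are enumerated by `Ls 0, …`,
`|D| = |R| + 1`, `w + s + 1 ≤ |R|`, and
`N · (2 (t+1) (|R|+t-w+1)²)^{s+1} · ((|D|-w)(|R|-w))^{s+1} < C(w+s+1, w)`,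
then some matching `ρ` of size `w` is good for threshold `s` with respect to every `Ls i`:
no play of the game on any `Ls i` from `ρ` meets more than `s` critical pairs. (For each bad
`ρ` the coding matching `τ ⊇ ρ` of size `w+s+1` and the code determine `ρ`; comparing the
number of `ρ`'s with the number of triples (list index, code, `τ`) via the double count of
pairs `ρ ⊆ τ` gives the contradiction.) [cite: Krajicek1995, Lemma 12.3.10] -/
theorem exists_good_restriction {D : Finset α} {R : Finset β} (hDR : D.card = R.card + 1)
    (Ls : ℕ → List (Finset (α × β))) (N t w s : ℕ)
    (hL : ∀ i < N, ∀ h ∈ Ls i, IsPMatching h ∧ h ⊆ D ×ˢ R ∧ h.card ≤ t)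
    (hw : w + s + 1 ≤ R.card)
    (hineq : N * ((t + 1) * ((R.card + t - w + 1) * (R.card + t - w + 1)) * 2) ^ (s + 1) *
        ((D.card - w) * (R.card - w)) ^ (s + 1) < Nat.choose (w + s + 1) w) :
    ∃ ρ : Finset (α × β), IsPMatching ρ ∧ ρ ⊆ D ×ˢ R ∧ ρ.card = w ∧
      ∀ i < N, Good (Ls i) D R ρ s := by
  by_contra hcon
  push Not at hcon
  set M := R.card + t - w with hM
  -- a bad witness for every matching of size `w`
  have hwit : ∀ ρ ∈ matchingsOfCard D R w, ∃ d : ℕ × List (Finset (α × β)) × Finset (α × β),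
      d.1 < N ∧ PlayValid (Ls d.1) D R ρ d.2.1 ∧ d.2.2 ⊆ crit (Ls d.1) (playEnd ρ d.2.1) ∧
        d.2.2 ≠ ∅ ∧ playCrit (Ls d.1) ρ d.2.1 + d.2.2.card = s + 1 := by
    intro ρ hρ
    obtain ⟨hρs, hρc, hρm⟩ := mem_matchingsOfCard.1 hρ
    obtain ⟨i, hi, hbad⟩ := hcon ρ hρm hρs hρc
    obtain ⟨pfx, extra, hv, hsub, hne, hcard⟩ := exists_witness hbad
    exact ⟨(i, pfx, extra), hi, hv, hsub, hne, hcard⟩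
  choose! dat hdat using hwit
  -- the injection `ρ ↦ (i, code, τ)`
  let f : Finset (α × β) → ℕ × Code t M s × Finset (α × β) := fun ρ =>
    ((dat ρ).1, toCode t M s (encode (Ls (dat ρ).1) D R ρ (dat ρ).2.1 (dat ρ).2.2),
      tauSet (Ls (dat ρ).1) ρ (dat ρ).2.1 (dat ρ).2.2)
  -- facts about the witness of `ρ`
  have hfacts : ∀ ρ ∈ matchingsOfCard D R w,
      (dat ρ).1 < N ∧ IsPMatching ρ ∧ ρ ⊆ D ×ˢ R ∧
      (∀ h ∈ Ls (dat ρ).1, IsPMatching h) ∧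
      tauSet (Ls (dat ρ).1) ρ (dat ρ).2.1 (dat ρ).2.2 ∈ matchingsOfCard D R (w + (s + 1)) ∧
      (encode (Ls (dat ρ).1) D R ρ (dat ρ).2.1 (dat ρ).2.2).length = s + 1 ∧
      (∀ x ∈ encode (Ls (dat ρ).1) D R ρ (dat ρ).2.1 (dat ρ).2.2,
        x.1.1 ≤ t ∧ x.1.2.1 ≤ M ∧ x.1.2.2 ≤ M) ∧
      tauSet (Ls (dat ρ).1) ρ (dat ρ).2.1 (dat ρ).2.2 \
        decRounds (Ls (dat ρ).1) D R (s + 1) (tauSet (Ls (dat ρ).1) ρ (dat ρ).2.1 (dat ρ).2.2)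
          (encode (Ls (dat ρ).1) D R ρ (dat ρ).2.1 (dat ρ).2.2) = ρ := by
    intro ρ hρ
    obtain ⟨hρs, hρc, hρm⟩ := mem_matchingsOfCard.1 hρ
    obtain ⟨hi, hv, hsub, hne, hcard⟩ := hdat ρ hρ
    have hLi := hL _ hi
    have hLm : ∀ h ∈ Ls (dat ρ).1, IsPMatching h := fun h hh => (hLi h hh).1
    have hLs : ∀ h ∈ Ls (dat ρ).1, h ⊆ D ×ˢ R := fun h hh => (hLi h hh).2.1
    have hLt : ∀ h ∈ Ls (dat ρ).1, h.card ≤ t := fun h hh => (hLi h hh).2.2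
    have hτcard : (tauSet (Ls (dat ρ).1) ρ (dat ρ).2.1 (dat ρ).2.2).card = w + (s + 1) := by
      rw [card_tauSet hv hsub, hρc, Nat.add_assoc, hcard]
    have hfuel : (dat ρ).2.1.length < s + 1 := by
      have := length_le_playCrit hv
      have := Finset.card_pos.2 (Finset.nonempty_iff_ne_empty.2 hne)
      omega
    refine ⟨hi, hρm, hρs, hLm, mem_matchingsOfCard.2 ⟨tauSet_subset_universe hLs hρs _ hsub, hτcard,
      isPMatching_tauSet hLm hv hρm hsub⟩, by rw [length_encode, hcard], fun x hx => ?_,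
      tauSet_sdiff_decRounds hLm hv hρm hsub hne hfuel⟩
    rw [encode, List.mem_append] at hx
    rcases hx with hx | hx
    · exact encRounds_bounds hLi hDR _ hv hρm hρs hsub (by rw [hτcard]; omega) x hx
    · obtain ⟨h1, h2, h3⟩ := encLast_bounds hLt hsub x hx
      exact ⟨h1, by rw [h2]; exact Nat.zero_le _, by rw [h3]; exact Nat.zero_le _⟩
  have hmaps : Set.MapsTo f ↑(matchingsOfCard D R w)
      ↑(Finset.range N ×ˢ ((Finset.univ : Finset (Code t M s)) ×ˢ matchingsOfCard D R (w + (s + 1)))) := by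
    intro ρ hρ
    obtain ⟨hi, -, -, -, hτ, -⟩ := hfacts ρ (Finset.mem_coe.1 hρ)
    rw [Finset.mem_coe, Finset.mem_product, Finset.mem_product]
    exact ⟨Finset.mem_range.2 hi, Finset.mem_univ _, hτ⟩
  have hinj : Set.InjOn f (matchingsOfCard D R w) := by
    intro ρ₁ hρ₁ ρ₂ hρ₂ heq
    obtain ⟨-, -, -, -, -, hlen₁, hb₁, hdec₁⟩ := hfacts ρ₁ (Finset.mem_coe.1 hρ₁)
    obtain ⟨-, -, -, -, -, hlen₂, hb₂, hdec₂⟩ := hfacts ρ₂ (Finset.mem_coe.1 hρ₂)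
    simp only [f, Prod.mk.injEq] at heq
    obtain ⟨hi, hcode, hτ⟩ := heq
    have hc := toCode_injective hlen₁ hlen₂ hb₁ hb₂ hcode
    calc ρ₁ = _ := hdec₁.symm
      _ = _ := by rw [hτ, hc, hi]
      _ = ρ₂ := hdec₂
  have hcard := Finset.card_le_card_of_injOn f hmaps hinj
  rw [Finset.card_product, Finset.card_product, Finset.card_range, Finset.card_univ] at hcard
  have hcode : Fintype.card (Code t M s) =
      ((t + 1) * ((R.card + t - w + 1) * (R.card + t - w + 1)) * 2) ^ (s + 1) := by
    simp only [Code, Fintype.card_fun, Fintype.card_prod, Fintype.card_fin, Fintype.card_bool, hM]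
  rw [hcode] at hcard
  -- the double count and the final contradiction
  have hdc := card_matchings_mul_choose_le D R w (s + 1)
  have hpos := (matchingsOfCard_nonempty (D := D) (R := R) (w := w) (by omega) (by omega)).card_pos
  set A := (matchingsOfCard D R w).card
  set B := (matchingsOfCard D R (w + (s + 1))).card
  set C := Nat.choose (w + (s + 1)) w
  set K := ((t + 1) * ((R.card + t - w + 1) * (R.card + t - w + 1)) * 2) ^ (s + 1)
  set U := ((D.card - w) * (R.card - w)) ^ (s + 1)
  have hineq' : N * K * U < C := by
    have e : w + (s + 1) = w + s + 1 := (Nat.add_assoc w s 1).symm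
    simp only [C, e]; exact hineq
  have h1 : A * C ≤ N * K * (B * C) := by
    calc A * C ≤ (N * (K * B)) * C := Nat.mul_le_mul_right _ hcard
      _ = N * K * (B * C) := by ring
  have h2 : N * K * (B * C) ≤ N * K * (A * U) := Nat.mul_le_mul_left _ hdc
  have h3 : N * K * (A * U) = A * (N * K * U) := by ring
  have h4 : A * (N * K * U) < A * C := Nat.mul_lt_mul_of_pos_left hineq' hpos
  omega

/-- **The PHP switching lemma** (Krajíček 1995, Lemma 12.3.10; Krajíček–Pudlák–Woods 1995;
cf. Krajíček 2019, Lemma 15.2.2), counting form. Let `|D| = |R| + 1`, let `H_0, …, H_{N-1}`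
(enumerated by the lists `Ls i`) be sets of matchings of the universe of norm `≤ t`, and let
`w + s + 1 ≤ |R|` satisfy
`N · (2 (t+1) (|R|+t-w+1)²)^{s+1} · ((|D|-w)(|R|-w))^{s+1} < C(w+s+1, w)`. Then there is a
matching `ρ` of size `w` such that for every `i < N` some `2s`-complete system `Sᵢ` over the
restricted universe `D^ρ × R^ρ` refines `Hᵢ^ρ`. (Krajíček's sufficient condition is
`w^s / ((n+1-w)^{4s} t^{3s}) > N`; ours is of the same shape, obtained with cruder counting.)
[cite: Krajicek1995, Lemma 12.3.10] -/
theorem php_switching {D : Finset α} {R : Finset β} (hDR : D.card = R.card + 1)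
    (Ls : ℕ → List (Finset (α × β))) (N t w s : ℕ)
    (hL : ∀ i < N, ∀ h ∈ Ls i, IsPMatching h ∧ h ⊆ D ×ˢ R ∧ h.card ≤ t)
    (hw : w + s + 1 ≤ R.card)
    (hineq : N * ((t + 1) * ((R.card + t - w + 1) * (R.card + t - w + 1)) * 2) ^ (s + 1) *
        ((D.card - w) * (R.card - w)) ^ (s + 1) < Nat.choose (w + s + 1) w) :
    ∃ ρ : Finset (α × β), IsPMatching ρ ∧ ρ ⊆ D ×ˢ R ∧ ρ.card = w ∧
      ∀ i < N, ∃ S : Finset (Finset (α × β)),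
        IsKComplete (D \ dom ρ) (R \ rng ρ) (2 * s) S ∧ Refines (restrict ρ (Ls i).toFinset) S := by
  obtain ⟨ρ, hρ, hρs, hρc, hgood⟩ := exists_good_restriction hDR Ls N t w s hL hw hineq
  refine ⟨ρ, hρ, hρs, hρc, fun i hi => ⟨leafSystem (Ls i) D R ρ, ?_, refines_leafSystem hρ hρs⟩⟩
  exact isKComplete_leafSystem (fun h hh => ⟨(hL i hi h hh).1, (hL i hi h hh).2.1⟩) (by omega)
    hρ hρs (hgood i hi)

end Literature.Computability.MetaComplexity.PBij
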